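import Literature.NumberTheory.GaloisRepresentations.LocalNormIndex
import Mathlib.RingTheory.Norm.Transitivity
import Literature.NumberTheory.EllipticCurves.TateCurve.NumberFieldUniformization
import Literature.NumberTheory.EllipticCurves.PAdicBSDSplitMultiplicativeProofs
import Mathlib.NumberTheory.Padics.HeightOneSpectrum
import Literature.NumberTheory.EllipticCurves.OrdinaryLocalReductionMapProofs
import Literature.NumberTheory.EllipticCurves.ReductionHomomorphismSurjectiveProofs
import Literature.NumberTheory.EllipticCurves.IwasawaSelmerControlLocalInputsProofs
import Literature.NumberTheory.EllipticCurves.GaloisActionProofs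
import Literature.RingTheory.DiscreteValuationRing.AdicCompletionHensel
import Literature.NumberTheory.GaloisRepresentations.GaloisRepUnramifiedProofs
import Literature.NumberTheory.EllipticCurves.FormalGroupKummerPointProofs
import Literature.NumberTheory.GaloisRepresentations.FrobeniusQuotientHOne
import Literature.NumberTheory.EllipticCurves.SelmerCorankProofs
import Literature.NumberTheory.EllipticCurves.IwasawaSelmerControlLocalizationProofs
import Literature.NumberTheory.GaloisRepresentations.AbsGaloisGroupCompact
import Literature.NumberTheory.EllipticCurves.Greenberg1999.LocalCyclotomicTowerLayerProofs
import Literature.NumberTheory.EllipticCurves.Greenberg1999.SplitMultiplicativeLocalTowerKernelPTorsionProofs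
import HarnessLib

/-!
# The local cyclotomic tower at a multiplicative / good ordinary prime: split-exact transfer, order transport, Hensel, coinvariant cocycles and Kummer theory, local `ℤ_p`-extensions, cocycle control (re-homed proofs, exact-order cone file 1 of 3)

Family `bsd` material RE-HOMED into `Literature/` by the Hodge foundations lane (`lit-hodgefound`, seat p20, generation 35),
file 1 of 3 of the EXACT-ORDER cone (continuing `LocalCyclotomicTowerLayerProofs` / `SplitMultiplicativeLocalTowerKernelPTorsionProofs`, whose
twelve modules are imported, not repeated): verbatim ports, in dependency order and each with its original module docstring (Parts 1–7), of the
cell `bsd-2adic` TOWER-road modules (route `ByReductionTypeAtTwo`, crux `MultUpperHalfAtTwo`, item stmt-BirchSwinnertonDyer-19922)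
ByReductionTypeAtTwoMultTowerSplitExactTransfer, ByReductionTypeAtTwoMultTowerSplitOrderTransport, ByReductionTypeAtTwoGoodOrdTowerHensel, ByReductionTypeAtTwoGoodOrdTowerCoinvCocycle, ByReductionTypeAtTwoGoodOrdTowerCoinvKummer, LocalZpExtension, ByReductionTypeAtTwoGoodOrdTowerControlCocycle (under `Summits/BirchSwinnertonDyer/BirchSwinnertonDyer/Theorems/`, resp. `Summits/BirchSwinnertonDyer/Rank1Residual/Additive/`
for `LocalZpExtension` / `LocalTowerKernelPrimaryExact`), namespaces re-rooted `Summit.BirchSwinnertonDyer.BirchSwinnertonDyer.Theorems.{MultTowerNS2,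
MultTowerSP1, MultTowerSplitExact, MultTowerSplitOrder, GoodOrdTower}` ↦ `Literature.NumberTheory.EllipticCurves.Greenberg1999.{…}` and
`Summit.BirchSwinnertonDyer.Rank1Residual.Additive` ↦ `Literature.NumberTheory.EllipticCurves.Greenberg1999.Rank1ResidualAdditive`; theorems only
(no definition, no named fact), imports Literature/Mathlib only; all `[folklore]` helpers privatised — Part 0 re-proves privately, verbatim with
their scope context, the `[folklore]` helpers of the earlier files that this file's parts use (they are private there); `open` commands of shadowed
Mathlib roots made `_root_`-explicit; the originals' section-wide instance declaration for `AdicCompletion.nontriviallyNormedField` is dropped (the one proof that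
needs it, `MultTowerSplitOrder.exists_tateUniformisation_tateJ` of file 1, now binds it with a proof-local `letI`).  CONTENT: transfer for the split exact sequence and order transport along the tower (Parts 1–2), Hensel lifting in the good ordinary tower (Part 3), coinvariant cocycles and their Kummer description (Parts 4–5), local `ℤ_p`-extensions (Part 6), control of cocycles (Part 7).  WHY: the three files complete, inside `Literature/`, the only proof in the tree of the Literature named fact
`NumberTheory.EllipticCurves.Greenberg1999.sec3_natCard_localTowerKerPrimary_splitMultiplicative_rat` (Greenberg LNM 1716 §3, PDF pp. 90–93: for
`W/ℚ` globally minimal with a Tate parameter datum at `p` and `log_p q_E ≠ 0`, `κ` cyclotomic, `v ∋ p`, there is `e` with `e + ord_p(2p) =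
ord_p(log_p q_E)` such that at EVERY layer the `p`-primary local tower kernel `𝒦_{v,n}[p^∞]` is finite of order `p^e`), which `Literature/`
could not import.  The Summits originals stay in place (transitional duplication; cited here).  Honest framing of the originals stands: nothing is
booked, BSD is not proved by any of this.
-/

noncomputable section

/-! ## Part 0 — 3 `[folklore]` helper(s) of `LocalCyclotomicTowerLayerProofs` / `SplitMultiplicativeLocalTowerKernelPTorsionProofs` (private there), re-proved privately (verbatim, with their scope context) -/

section Part0

-- from `ByReductionTypeAtTwoMultTowerNS2LocalLayerField`
set_option autoImplicit false
section
namespace Literature.NumberTheory.EllipticCurves.Greenberg1999.MultTowerNS2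
open _root_.NumberField _root_.IsDedekindDomain _root_.Field Literature.NumberTheory.EllipticCurves
  Literature.NumberTheory.GaloisRepresentations
universe u
/-- `localSubgroup H E = res⁻¹(H)` is open in `Γ_E` when `H` is open in `Γ_K` (the restriction `resGal E` is
continuous). [folklore] -/
private theorem isOpen_localSubgroup {K : Type u} [Field K] (H : Subgroup (absoluteGaloisGroup K))
    (hH : IsOpen (H : Set (absoluteGaloisGroup K))) (E : Type u) [Field E] [Algebra K E] :
    IsOpen (localSubgroup H E : Set (absoluteGaloisGroup E)) :=
  hH.preimage (resGal (K := K) E).continuous_toFun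
end Literature.NumberTheory.EllipticCurves.Greenberg1999.MultTowerNS2
end

-- from `ByReductionTypeAtTwoMultTowerNS2LayerNormGroup`
set_option autoImplicit false
section
open scoped _root_.Classical _root_.IntermediateField
namespace Literature.NumberTheory.EllipticCurves.Greenberg1999.MultTowerNS2
open _root_.NumberField _root_.IsDedekindDomain _root_.Field _root_.PadicInt Literature.NumberTheory.EllipticCurves
  Literature.NumberTheory.GaloisRepresentations
/-- Two subgroups `T ≤ S` of the same finite index are equal. [folklore] -/
private theorem subgroup_eq_of_le_of_index_eq {G : Type*} [Group G] {T S : Subgroup G} (h : T ≤ S)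
    (hidx : T.index = S.index) (h0 : S.index ≠ 0) : T = S := by
  refine le_antisymm h ?_
  have hmul := Subgroup.relIndex_mul_index h
  rw [hidx] at hmul
  have hrel : T.relIndex S = 1 := by
    have : T.relIndex S * S.index = 1 * S.index := by rw [hmul, one_mul]
    exact mul_right_cancel₀ h0 this
  exact Subgroup.relIndex_eq_one.mp hrel
end Literature.NumberTheory.EllipticCurves.Greenberg1999.MultTowerNS2
end

-- from `ByReductionTypeAtTwoMultTowerNS2TateTransport`
set_option autoImplicit false
section
open scoped _root_.Classical
namespace Literature.NumberTheory.EllipticCurves.Greenberg1999.MultTowerNS2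
open _root_.NumberField _root_.IsDedekindDomain _root_.Field Literature.NumberTheory.EllipticCurves
  Literature.NumberTheory.GaloisRepresentations
variable {κ : ZpExtension ℚ 2}
/-- **If `h x = Q^j x` with `h Q = Q` and `Q` of infinite order, then `h x = x`.** The `h`-orbit of the algebraic
element `x` lies in the root set of its minimal polynomial, so `h^d x = x` for some `d ≥ 1`, while
`h^d x = Q^{jd} x`; hence `Q^{jd} = 1`, `j = 0`. [folklore] -/
private theorem smul_eq_self_of_smul_eq_zpow_mul (v : HeightOneSpectrum (𝓞 ℚ))
    {h : absoluteGaloisGroup (v.adicCompletion ℚ)} {Q x : AlgebraicClosure (v.adicCompletion ℚ)}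
    (hQfix : h • Q = Q) (hQ0 : Q ≠ 0) (hQtor : ∀ j : ℤ, Q ^ j = 1 → j = 0) (hx0 : x ≠ 0) {j : ℤ}
    (hj : h • x = Q ^ j * x) : h • x = x := by
  -- `h^m x = Q^{jm} x`
  have hpow : ∀ m : ℕ, (h ^ m) • x = Q ^ (j * m) * x := fun m ↦ by
    induction m with
    | zero => simp
    | succ m ih =>
      rw [pow_succ', mul_smul, ih, smul_mul', smul_zpow₀', hQfix, hj, ← mul_assoc, ← zpow_add₀ hQ0]
      push_cast
      ring_nf
  -- the orbit lies in the (finite) root set of the minimal polynomial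
  have hint : IsIntegral (v.adicCompletion ℚ) x := Algebra.IsIntegral.isIntegral x
  have hmem : ∀ m : ℕ, (h ^ m) • x ∈ (minpoly (v.adicCompletion ℚ) x).rootSet (AlgebraicClosure (v.adicCompletion ℚ)) :=
    fun m ↦ by
      rw [Polynomial.mem_rootSet]
      refine ⟨minpoly.ne_zero hint, ?_⟩
      have e1 := Polynomial.aeval_algHom_apply
        ((absoluteGaloisGroup.toAlgEquiv (v.adicCompletion ℚ) (h ^ m) :
          AlgebraicClosure (v.adicCompletion ℚ) ≃ₐ[v.adicCompletion ℚ] AlgebraicClosure (v.adicCompletion ℚ)) :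
          AlgebraicClosure (v.adicCompletion ℚ) →ₐ[v.adicCompletion ℚ] AlgebraicClosure (v.adicCompletion ℚ))
        x (minpoly (v.adicCompletion ℚ) x)
      rw [minpoly.aeval, map_zero] at e1
      exact e1
  let f : ℕ → (minpoly (v.adicCompletion ℚ) x).rootSet (AlgebraicClosure (v.adicCompletion ℚ)) :=
    fun m ↦ ⟨(h ^ m) • x, hmem m⟩
  obtain ⟨m₁, m₂, hne, heq⟩ := Finite.exists_ne_map_eq_of_infinite f
  have heq' : (h ^ m₁) • x = (h ^ m₂) • x := congrArg Subtype.val heq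
  -- `h^d x = x` with `d ≥ 1` forces `j = 0`
  have key : ∀ {a b : ℕ}, a < b → (h ^ a) • x = (h ^ b) • x → h • x = x := by
    intro a b hab hab'
    obtain ⟨d, rfl⟩ := Nat.exists_eq_add_of_lt hab
    rw [show a + d + 1 = a + (d + 1) by ring, pow_add, mul_smul] at hab'
    have h1 : x = (h ^ (d + 1)) • x := smul_left_cancel _ hab'
    rw [hpow] at h1
    have h2 : Q ^ (j * (d + 1 : ℕ)) = 1 := by
      have h3 : Q ^ (j * (d + 1 : ℕ)) * x = 1 * x := by rw [one_mul]; exact h1.symm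
      exact mul_right_cancel₀ hx0 h3
    have h4 := hQtor _ h2
    have hj0 : j = 0 := by
      rcases mul_eq_zero.mp h4 with h5 | h5
      · exact h5
      · exfalso; push_cast at h5; omega
    rw [hj, hj0, zpow_zero, one_mul]
  rcases lt_or_gt_of_ne hne with hlt | hlt
  · exact key hlt heq'
  · exact key hlt heq'.symm
end Literature.NumberTheory.EllipticCurves.Greenberg1999.MultTowerNS2
end

end Part0

/-!
## Part 1 — port of `Summits/BirchSwinnertonDyer/BirchSwinnertonDyer/Theorems/ByReductionTypeAtTwoMultTowerSplitExactTransfer.lean`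

# Route `ByReductionTypeAtTwo`, crux `MultUpperHalfAtTwo` (item stmt-BirchSwinnertonDyer-19922), TOWER road, SPLIT rows:
# the EXACT order of the local tower kernel at a split multiplicative prime, part 2 (any prime `p`) — the NORM TRANSFER
# `q ∈ N(F_{m+w}/F_m) ⟸ q^{p^m} ∈ N(F_{m+w}/ℚ_v)` for the cyclic layers of the local cyclotomic `ℤ_p`-tower

HONEST FRAMING (cell `bsd-2adic`, run/shared/lean/pub/bsd-2adic/, seat `bsd-2adic-tower-1` GEN 27, HUMAN RULINGS
D-0036 / D-0054 / D-0074): TOOL theorems only (no definition, no named fact, no `sorry`); closes nothing by itself;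
nothing booked; BSD is not proved by any of this. Second module of the LOWER half of the PRINT binder
`hSP = Greenberg1999.sec3_natCard_localTowerKerPrimary_splitMultiplicative_rat` (Greenberg, LNM 1716, §3 pp. 92–93).
Part 1 (`…MultTowerSplitExactLower.lean`) turns an element `x ∈ F_{m+w}` with relative norm
`N_{F_{m+w}/F_m}(x) = ∏_{i<p^w} g^i x = q_E` into `p^w ≤ #𝒦_{v,m}[p^∞]`; this file PRODUCES such an `x` from the
hypothesis `q_E^{p^m} ∈ N(F_{m+w}/ℚ_v)` — a statement about the norm group of ONE layer over the BASE `ℚ_v`, which is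
where the reduction type enters (part 3: at `p = 2` by BRICK 14 `MultTowerNS2.mem_range_norm_fixedField_layer_iff`,
`N(F_mˣ) = ⟨2⟩·±(1 + 2^{m+2}ℤ₂)`).

Setting (any prime `p`): `κ` the cyclotomic `ℤ_p`-extension, `v ∋ p`, `K = ℚ_v`, `Γ = Gal(K̄/K)`, `H_m` the local layer
subgroups, `F_m = K̄^{H_m}` (Galois over `K`, cyclic of degree `p^m`), `g ∈ H_m` with `κ(res g) = p^m u_g`.

* `isGalois_fixedField_of_isOpen_of_normal`, `isCyclic_gal_fixedField_layer`, `index_range_norm_fixedField_layer` — the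
  `p`-general forms of GEN 9's BRICK 14 preliminaries (`…MultTowerNS2LayerNormGroup.lean`, stated there for `p = 2`): `F_m/ℚ_v` is
  Galois, cyclic, and `[ℚ_vˣ : N(F_mˣ)] = p^m` (the tree's PROVED class field axiom
  `normIndex_eq_finrank_of_isNonarchimedeanLocalField`, Neukirch V (1.1));
* `fixedField_layer_le` — `F_m ≤ F_{m+w}`;
* `exists_prod_smul_eq_of_pow_mem_range_norm` — **if `q^{p^m} ∈ N(F_{m+w}ˣ)` (norm to `ℚ_v`) then some
  `x ∈ K̄ˣ` fixed by `H_{m+w}` has `∏_{i<p^w} g^i x = q`** — the input `hxw`/`hNx` of part 1. Inside: (relative orbit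
  product = relative norm) `N_{F_{m+w}/F_m}(z) = ∏_{i<p^w} g^i z` in `K̄`, since `Gal(F_{m+w}/F_m) = {g^i|}_{i<p^w}`;
  (the transfer by COUNTING) the kernel of `N_{F_m/ℚ_v}` on `F_mˣ` lies in `N(F_{m+w}/F_m)` — from `Subgroup.index_map`
  and the three class-field indices `p^m`, `p^{m+w}`, `p^w` (`[F_mˣ : N(F_{m+w}/F_m)] = p^w`, the axiom for the cyclic layer
  `F_{m+w}/F_m` of the local field `F_m`, `normIndex_eq_finrank_of_isNonarchimedeanLocalField ℚ_v F_m F_{m+w}`).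

References: R. Greenberg, LNM 1716 (1999), §3 pp. 85–93; J. Neukirch, *ANT* IV §1, V §1 Thm. (1.1);
L. Washington, *Introduction to Cyclotomic Fields*, §13.1; cell memo SCOPE-hNS2one-kernel-GEN8.md S5 (the counting transfer).
-/

section Part1

set_option autoImplicit false

open scoped _root_.Classical _root_.IntermediateField

namespace Literature.NumberTheory.EllipticCurves.Greenberg1999.MultTowerSplitExact

open _root_.NumberField _root_.IsDedekindDomain _root_.Field _root_.PadicInt _root_.Rat.HeightOneSpectrum
  Literature.NumberTheory.EllipticCurves Literature.NumberTheory.GaloisRepresentations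
  Literature.NumberTheory.EllipticCurves.Greenberg1999.MultTowerNS2

variable {p : ℕ} [hp : Fact p.Prime] {κ : ZpExtension ℚ p}

/-! ### `F_m / ℚ_v` is Galois, cyclic, with norm index `p^m` (any `p`) -/

/-- **`K̄^H/ℚ_v` is Galois for an OPEN NORMAL subgroup `H ≤ Γ_{ℚ_v}`** (Krull: the fixing subgroup of `K̄^H` is `H`
itself, and normality of the subgroup is normality of the extension). Applied below to the local layer subgroups `H_m`
at any prime `p` (GEN 9's `MultTowerNS2.isGalois_fixedField_localSubgroup_layerSubgroup` is the case `H = H_m`, `p = 2`).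
[cite: Washington1997, §13.1] [cite: NeukirchANT1999, Ch. IV §1] -/
theorem isGalois_fixedField_of_isOpen_of_normal (v : HeightOneSpectrum (𝓞 ℚ))
    (H : Subgroup (absoluteGaloisGroup (v.adicCompletion ℚ)))
    (hopen : IsOpen (H : Set (absoluteGaloisGroup (v.adicCompletion ℚ)))) (hnormal : H.Normal) :
    IsGalois (v.adicCompletion ℚ) (IntermediateField.fixedField H) := by
  haveI : CharZero (v.adicCompletion ℚ) :=
    charZero_of_injective_algebraMap (algebraMap ℚ (v.adicCompletion ℚ)).injective
  have hfix := fixingSubgroup_fixedField_of_isOpen _ hopen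
  have key := fun x ↦ SetLike.ext_iff.mp hfix x
  refine (InfiniteGalois.normal_iff_isGalois _).mp ?_
  exact ⟨fun a ha b ↦ (key _).mpr (hnormal.conj_mem a ((key a).mp ha) b)⟩

/-- **`Gal(F_m/ℚ_v)` is cyclic** (any `p`): `Γ_{ℚ_v}/H_m ≅ ℤ_p/p^m ≅ ℤ/p^m` (`κ ∘ res_v` onto) and Krull. The
`p`-general form of `MultTowerNS2.isCyclic_gal_fixedField_localSubgroup_layerSubgroup`. [cite: Washington1997, §13.1] -/
theorem isCyclic_gal_fixedField_layer (hκ : κ.IsCyclotomic) (v : HeightOneSpectrum (𝓞 ℚ))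
    (hv : ((p : ℕ) : 𝓞 ℚ) ∈ v.asIdeal) (m : ℕ) :
    IsCyclic (IntermediateField.fixedField (localSubgroup (κ.layerSubgroup m) (v.adicCompletion ℚ)) ≃ₐ[v.adicCompletion ℚ]
      IntermediateField.fixedField (localSubgroup (κ.layerSubgroup m) (v.adicCompletion ℚ))) := by
  have hopen : IsOpen (localSubgroup (κ.layerSubgroup m) (v.adicCompletion ℚ) :
      Set (absoluteGaloisGroup (v.adicCompletion ℚ))) :=
    isOpen_localSubgroup (κ.layerSubgroup m) (κ.isOpen_layerSubgroup m) (v.adicCompletion ℚ)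
  have hnormal : (localSubgroup (κ.layerSubgroup m) (v.adicCompletion ℚ)).Normal := by
    rw [localSubgroup_eq_comap]; exact Subgroup.Normal.comap inferInstance _
  have hclosed := (localSubgroup (κ.layerSubgroup m) (v.adicCompletion ℚ)).isClosed_of_isOpen hopen
  let φ : absoluteGaloisGroup (v.adicCompletion ℚ) →* Multiplicative (ZMod (p ^ m)) :=
    (AddMonoidHom.toMultiplicative (toZModPow (p := p) m).toAddMonoidHom).comp
      (κ.toContinuousMonoidHom.toMonoidHom.comp (resGal (K := ℚ) (v.adicCompletion ℚ)).toMonoidHom)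
  have hφ : Function.Surjective φ := by
    intro c
    obtain ⟨t, ht⟩ := ZMod.ringHom_surjective (toZModPow (p := p) m) c.toAdd
    obtain ⟨σ, hσ⟩ := surjective_kappa_comp_resGal hκ v hv (Multiplicative.ofAdd t)
    refine ⟨σ, ?_⟩
    change Multiplicative.ofAdd (toZModPow m (Multiplicative.toAdd
      ((κ.toContinuousMonoidHom.toMonoidHom.comp (resGal (K := ℚ) (v.adicCompletion ℚ)).toMonoidHom) σ))) = c
    rw [hσ, toAdd_ofAdd, ht, ofAdd_toAdd]
  have hker : φ.ker = localSubgroup (κ.layerSubgroup m) (v.adicCompletion ℚ) := by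
    ext σ
    rw [MonoidHom.mem_ker, mem_localSubgroup_iff, ZpExtension.mem_layerSubgroup, ← Ideal.mem_span_singleton,
      ← ker_toZModPow, RingHom.mem_ker]
    constructor
    · intro h
      exact congrArg Multiplicative.toAdd h
    · intro h
      exact congrArg Multiplicative.ofAdd h
  let Hc : ClosedSubgroup (AlgebraicClosure (v.adicCompletion ℚ) ≃ₐ[v.adicCompletion ℚ]
      AlgebraicClosure (v.adicCompletion ℚ)) := ⟨localSubgroup (κ.layerSubgroup m) (v.adicCompletion ℚ), hclosed⟩
  haveI hN : Hc.toSubgroup.Normal := hnormal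
  haveI hcyc0 : IsCyclic (absoluteGaloisGroup (v.adicCompletion ℚ) ⧸ φ.ker) :=
    isCyclic_of_surjective _ (QuotientGroup.quotientKerEquivOfSurjective φ hφ).symm.surjective
  haveI hC : IsCyclic ((AlgebraicClosure (v.adicCompletion ℚ) ≃ₐ[v.adicCompletion ℚ]
      AlgebraicClosure (v.adicCompletion ℚ)) ⧸ Hc.toSubgroup) :=
    isCyclic_of_surjective _ (QuotientGroup.quotientMulEquivOfEq hker).surjective
  haveI : CharZero (v.adicCompletion ℚ) :=
    charZero_of_injective_algebraMap (algebraMap ℚ (v.adicCompletion ℚ)).injective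
  exact isCyclic_of_surjective _ (InfiniteGalois.normalAutEquivQuotient Hc).surjective

/-- **`[ℚ_vˣ : N(F_mˣ)] = p^m`** (any `p`) — the CLASS FIELD AXIOM (Neukirch V (1.1), PROVED in the tree:
`index_range_norm_eq_finrank_of_isCyclic`) for the cyclic extension `F_m/ℚ_v` of degree `p^m`. The `p`-general form of
`MultTowerNS2.index_range_norm_fixedField_layer`. [cite: NeukirchANT1999, Ch. V §1 Thm. (1.1)] -/
theorem index_range_norm_fixedField_layer (hκ : κ.IsCyclotomic) (v : HeightOneSpectrum (𝓞 ℚ))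
    (hv : ((p : ℕ) : 𝓞 ℚ) ∈ v.asIdeal) (m : ℕ) :
    (Units.map (Algebra.norm (v.adicCompletion ℚ) :
        IntermediateField.fixedField (localSubgroup (κ.layerSubgroup m) (v.adicCompletion ℚ)) →*
          v.adicCompletion ℚ)).range.index = p ^ m := by
  haveI := finiteDimensional_fixedField_localSubgroup_layerSubgroup (κ := κ) v m
  haveI := isGalois_fixedField_of_isOpen_of_normal v (localSubgroup (κ.layerSubgroup m) (v.adicCompletion ℚ))
    (isOpen_localSubgroup (κ.layerSubgroup m) (κ.isOpen_layerSubgroup m) (v.adicCompletion ℚ))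
    (by rw [localSubgroup_eq_comap]; exact Subgroup.Normal.comap inferInstance _)
  haveI := isCyclic_gal_fixedField_layer hκ v hv m
  rw [index_range_norm_eq_finrank_of_isCyclic (v.adicCompletion ℚ), finrank_fixedField_localSubgroup_layerSubgroup hκ v hv m]

/-! ### The relative layer `F_{m+w}/F_m`: orbit product = norm, and the transfer -/

/-- `F_m ≤ F_{m+w}` (the local layer fields increase). [folklore] -/
private theorem fixedField_layer_le (v : HeightOneSpectrum (𝓞 ℚ)) (m w : ℕ) :
    IntermediateField.fixedField (localSubgroup (κ.layerSubgroup m) (v.adicCompletion ℚ)) ≤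
      IntermediateField.fixedField (localSubgroup (κ.layerSubgroup (m + w)) (v.adicCompletion ℚ)) := by
  intro x hx
  rw [IntermediateField.mem_fixedField_iff] at hx ⊢
  intro h hh
  exact hx h (Subgroup.comap_mono (κ.layerSubgroup_antitone (Nat.le_add_right m w)) hh)

/-- **The transfer package for the cyclic layer `F_{m+w}/F_m` (any `p`).** For `g ∈ H_m` with `κ(res g) = p^m u_g` and
`q ∈ ℚ_vˣ` with `q^{p^m} ∈ N(F_{m+w}ˣ)` (norms to `ℚ_v`), there is `x ∈ K̄ˣ` fixed by `H_{m+w}` with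
`∏_{i<p^w} g^i x = q`. Proof: in the tower `ℚ_v ⊆ F_m ⊆ F_{m+w}` (intermediate fields of `K̄_v`,
`LocalWeilDatum.towerAlgebra`), `F_{m+w}/F_m` is Galois with group `{g^i|}_{i<p^w}` (restrictions distinct since
`g^i ∈ H_{m+w} ↔ p^w ∣ i`, and `#Gal = [F_{m+w} : F_m] = p^w`), hence cyclic, and
`N_{F_{m+w}/F_m}(z) = ∏_{i<p^w} g^i z`; the class field axiom gives `[F_mˣ : N(F_{m+w}/F_m)] = p^w`, and with
`[ℚ_vˣ : N F_m] = p^m`, `[ℚ_vˣ : N F_{m+w}] = p^{m+w}` and `N_{F_m} ∘ N_{F_{m+w}/F_m} = N_{F_{m+w}}`, `Subgroup.index_map`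
forces `ker N_{F_m/ℚ_v} ≤ N(F_{m+w}/F_m)`; as `N_{F_m/ℚ_v}(q) = q^{p^m} ∈ N(F_{m+w}ˣ) = N_{F_m}(N(F_{m+w}/F_m))`, the element
`q ∈ F_mˣ` differs from a relative norm by an element of that kernel, so `q = N_{F_{m+w}/F_m}(z)`.
[cite: NeukirchANT1999, Ch. IV §1 and Ch. V §1 Thm. (1.1)] [cite: Washington1997, §13.1] -/
theorem exists_prod_smul_eq_of_pow_mem_range_norm (hκ : κ.IsCyclotomic) (v : HeightOneSpectrum (𝓞 ℚ))
    (hv : ((p : ℕ) : 𝓞 ℚ) ∈ v.asIdeal) (m w : ℕ) {g : absoluteGaloisGroup (v.adicCompletion ℚ)}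
    (hgm : g ∈ localSubgroup (κ.layerSubgroup m) (v.adicCompletion ℚ)) {ug : ℤ_[p]ˣ}
    (hug : ((κ (resGal (K := ℚ) (v.adicCompletion ℚ) g)).toAdd : ℤ_[p]) = (p : ℤ_[p]) ^ m * (ug : ℤ_[p]))
    (q : (v.adicCompletion ℚ)ˣ)
    (hmem : q ^ p ^ m ∈ (Units.map (Algebra.norm (v.adicCompletion ℚ) :
        IntermediateField.fixedField (localSubgroup (κ.layerSubgroup (m + w)) (v.adicCompletion ℚ)) →*
          v.adicCompletion ℚ)).range) :
    ∃ x : (AlgebraicClosure (v.adicCompletion ℚ))ˣ,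
      (∀ h ∈ localSubgroup (κ.layerSubgroup (m + w)) (v.adicCompletion ℚ),
        h • (x : AlgebraicClosure (v.adicCompletion ℚ)) = x) ∧
      (∏ i ∈ Finset.range (p ^ w), (g ^ i) • (x : AlgebraicClosure (v.adicCompletion ℚ))) =
        algebraMap (v.adicCompletion ℚ) (AlgebraicClosure (v.adicCompletion ℚ)) (q : v.adicCompletion ℚ) := by
  -- the groups (built before `CharZero ℚ_v` enters the context, as in BRICK 17)
  set Hm : Subgroup (absoluteGaloisGroup (v.adicCompletion ℚ)) := localSubgroup (κ.layerSubgroup m) (v.adicCompletion ℚ)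
    with hHm
  set Hmw : Subgroup (absoluteGaloisGroup (v.adicCompletion ℚ)) :=
    localSubgroup (κ.layerSubgroup (m + w)) (v.adicCompletion ℚ) with hHmw
  have hopen : IsOpen (Hmw : Set (absoluteGaloisGroup (v.adicCompletion ℚ))) :=
    isOpen_localSubgroup (κ.layerSubgroup (m + w)) (κ.isOpen_layerSubgroup (m + w)) (v.adicCompletion ℚ)
  have hidxK := index_range_norm_fixedField_layer hκ v hv m
  have hidxL := index_range_norm_fixedField_layer hκ v hv (m + w)
  haveI hfinK := finiteDimensional_fixedField_localSubgroup_layerSubgroup (κ := κ) v m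
  haveI hfinL := finiteDimensional_fixedField_localSubgroup_layerSubgroup (κ := κ) v (m + w)
  haveI hGalL := isGalois_fixedField_of_isOpen_of_normal v Hmw hopen
    (by rw [hHmw, localSubgroup_eq_comap]; exact Subgroup.Normal.comap inferInstance _)
  haveI hcycL := isCyclic_gal_fixedField_layer hκ v hv (m + w)
  have hrkK := finrank_fixedField_localSubgroup_layerSubgroup hκ v hv m
  have hrkL := finrank_fixedField_localSubgroup_layerSubgroup hκ v hv (m + w)
  have hpowmem : ∀ i : ℕ, g ^ i ∈ Hmw ↔ p ^ w ∣ i := fun i ↦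
    MultTowerSP1.pow_mem_localSubgroup_layerSubgroup_iff (κ := κ) v m w hug i
  have hKL := fixedField_layer_le (κ := κ) v m w
  -- (`CharZero ℚ_v` from here on)
  haveI : CharZero (v.adicCompletion ℚ) :=
    charZero_of_injective_algebraMap (algebraMap ℚ (v.adicCompletion ℚ)).injective
  set K₀ : IntermediateField (v.adicCompletion ℚ) (AlgebraicClosure (v.adicCompletion ℚ)) :=
    IntermediateField.fixedField Hm with hK₀
  set L₀ : IntermediateField (v.adicCompletion ℚ) (AlgebraicClosure (v.adicCompletion ℚ)) :=
    IntermediateField.fixedField Hmw with hL₀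
  have memK : ∀ {x : AlgebraicClosure (v.adicCompletion ℚ)}, x ∈ K₀ ↔ ∀ h ∈ Hm, h • x = x := fun {x} ↦ by
    rw [hK₀, IntermediateField.mem_fixedField_iff]; rfl
  have memL : ∀ {x : AlgebraicClosure (v.adicCompletion ℚ)}, x ∈ L₀ ↔ ∀ h ∈ Hmw, h • x = x := fun {x} ↦ by
    rw [hL₀, IntermediateField.mem_fixedField_iff]; rfl
  have hfix := fixingSubgroup_fixedField_of_isOpen Hmw hopen
  have keyfix : ∀ σ : absoluteGaloisGroup (v.adicCompletion ℚ), σ ∈ L₀.fixingSubgroup ↔ σ ∈ Hmw := fun σ ↦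
    SetLike.ext_iff.mp hfix σ
  -- the tower `ℚ_v ⊆ K₀ ⊆ L₀`
  letI : Algebra K₀ L₀ := LocalWeilDatum.towerAlgebra hKL
  haveI : IsScalarTower (v.adicCompletion ℚ) K₀ L₀ := LocalWeilDatum.towerAlgebra_isScalarTower_bot hKL
  haveI hfinKL : FiniteDimensional K₀ L₀ := LocalWeilDatum.towerAlgebra_finiteDimensional hKL
  haveI hGal : IsGalois K₀ L₀ := IsGalois.tower_top_of_isGalois (v.adicCompletion ℚ) K₀ L₀
  haveI : Module.Free K₀ L₀ := Module.Free.of_divisionRing K₀ L₀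
  haveI : Module.Free (v.adicCompletion ℚ) K₀ := Module.Free.of_divisionRing _ _
  have hrk : Module.finrank K₀ L₀ = p ^ w := by
    have h := Module.finrank_mul_finrank (v.adicCompletion ℚ) K₀ L₀
    rw [hrkK, hrkL, pow_add] at h
    exact Nat.eq_of_mul_eq_mul_left (pow_pos hp.out.pos m) h
  -- `Gal(L₀/K₀)` is cyclic (it embeds in the cyclic `Gal(L₀/ℚ_v)`)
  haveI : IsCyclic (L₀ ≃ₐ[K₀] L₀) := by
    let ρ : (L₀ ≃ₐ[K₀] L₀) →* (L₀ ≃ₐ[v.adicCompletion ℚ] L₀) :=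
      { toFun := fun σ ↦ σ.restrictScalars (v.adicCompletion ℚ)
        map_one' := by ext; rfl
        map_mul' := fun a b ↦ by ext; rfl }
    exact isCyclic_of_injective ρ fun a b h ↦ AlgEquiv.ext fun x ↦ by
      have := congrArg (fun f : L₀ ≃ₐ[v.adicCompletion ℚ] L₀ ↦ f x) h
      exact this
  -- the CLASS FIELD AXIOM for the layer `[K₀ˣ : N(L₀/K₀)] = p^w`
  have hidxKL : (Units.map (Algebra.norm K₀ : L₀ →* K₀)).range.index = p ^ w := by
    rw [normIndex_eq_finrank_of_isNonarchimedeanLocalField (v.adicCompletion ℚ) K₀ L₀, hrk]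
  -- the three norm maps on units and transitivity
  set NK : K₀ˣ →* (v.adicCompletion ℚ)ˣ := Units.map (Algebra.norm (v.adicCompletion ℚ) : K₀ →* v.adicCompletion ℚ)
    with hNK
  set NL : L₀ˣ →* (v.adicCompletion ℚ)ˣ := Units.map (Algebra.norm (v.adicCompletion ℚ) : L₀ →* v.adicCompletion ℚ)
    with hNL
  set NKL : L₀ˣ →* K₀ˣ := Units.map (Algebra.norm K₀ : L₀ →* K₀) with hNKL
  have htrans : ∀ z : L₀ˣ, NK (NKL z) = NL z := fun z ↦ Units.ext (by
    simp only [hNK, hNL, hNKL, Units.coe_map]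
    exact Algebra.norm_norm)
  have hmapB : NKL.range.map NK = NL.range := by
    ext y
    constructor
    · rintro ⟨b, ⟨z, rfl⟩, rfl⟩
      exact ⟨z, (htrans z).symm⟩
    · rintro ⟨z, rfl⟩
      exact ⟨NKL z, ⟨z, rfl⟩, htrans z⟩
  -- the transfer by counting: `ker NK ≤ N(L₀/K₀)`
  have hkerle : NK.ker ≤ NKL.range := by
    have h1 := Subgroup.index_map (G := K₀ˣ) NKL.range NK
    rw [hmapB, hidxL, hidxK, pow_add, mul_comm] at h1
    -- `p^w * p^m = (B' ⊔ ker).index * p^m`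
    have h2 : (NKL.range ⊔ NK.ker).index = p ^ w :=
      (Nat.eq_of_mul_eq_mul_right (pow_pos hp.out.pos m) h1).symm
    have h3 : NKL.range = NKL.range ⊔ NK.ker :=
      subgroup_eq_of_le_of_index_eq (le_sup_left : NKL.range ≤ NKL.range ⊔ NK.ker) (by rw [hidxKL, h2])
        (by rw [h2]; exact pow_ne_zero _ hp.out.ne_zero)
    rw [h3]
    exact le_sup_right
  -- `q ∈ K₀ˣ` and `NK q = q^{p^m}`
  have hqK : algebraMap (v.adicCompletion ℚ) (AlgebraicClosure (v.adicCompletion ℚ)) (q : v.adicCompletion ℚ) ∈ K₀ :=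
    memK.mpr fun h _ ↦ AlgEquiv.commutes (absoluteGaloisGroup.toAlgEquiv _ h) _
  set y : K₀ˣ := Units.mk0 (algebraMap (v.adicCompletion ℚ) K₀ (q : v.adicCompletion ℚ))
    (by rw [ne_eq, map_eq_zero_iff _ (algebraMap (v.adicCompletion ℚ) K₀).injective]; exact q.ne_zero) with hy
  have hNKy : NK y = q ^ p ^ m := Units.ext (by
    simp only [hNK, hy, Units.coe_map, Units.val_mk0, Units.val_pow_eq_pow_val]
    rw [Algebra.norm_algebraMap, hrkK])
  -- hence `y ∈ N(L₀/K₀)`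
  have hyB : y ∈ NKL.range := by
    have h1 : NK y ∈ NKL.range.map NK := by rw [hmapB, hNKy]; exact hmem
    obtain ⟨b, hb, hNb⟩ := h1
    have h2 : y * b⁻¹ ∈ NK.ker := by rw [MonoidHom.mem_ker, map_mul, map_inv, ← hNb, mul_inv_cancel]
    have h3 := hkerle h2
    have h4 : y = (y * b⁻¹) * b := by rw [inv_mul_cancel_right]
    rw [h4]
    exact mul_mem h3 hb
  obtain ⟨z, hz⟩ := hyB
  -- `Gal(L₀/K₀) = {g^i|}_{i<p^w}` and the relative orbit product
  have hgiK : ∀ (i : ℕ) (k : K₀), (g ^ i) • (k : AlgebraicClosure (v.adicCompletion ℚ)) = k := fun i k ↦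
    memK.mp k.2 (g ^ i) (Hm.pow_mem hgm i)
  haveI : Hmw.Normal := by rw [hHmw, localSubgroup_eq_comap]; exact Subgroup.Normal.comap inferInstance _
  let r : ℕ → (L₀ ≃ₐ[v.adicCompletion ℚ] L₀) := fun i ↦
    (absoluteGaloisGroup.toAlgEquiv (v.adicCompletion ℚ) (g ^ i)).restrictNormal L₀
  have hr : ∀ (i : ℕ) (x : L₀), ((r i x : L₀) : AlgebraicClosure (v.adicCompletion ℚ)) =
      (g ^ i) • (x : AlgebraicClosure (v.adicCompletion ℚ)) := fun i x ↦
    AlgEquiv.restrictNormal_commutes _ L₀ x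
  let τ : ℕ → (L₀ ≃ₐ[K₀] L₀) := fun i ↦ AlgEquiv.ofRingEquiv (f := (r i).toRingEquiv) (fun k ↦ by
    apply Subtype.ext
    change ((r i (algebraMap K₀ L₀ k) : L₀) : AlgebraicClosure (v.adicCompletion ℚ)) =
      ((algebraMap K₀ L₀ k : L₀) : AlgebraicClosure (v.adicCompletion ℚ))
    rw [hr, LocalWeilDatum.towerAlgebra_algebraMap_apply]
    exact hgiK i k)
  have hτ : ∀ (i : ℕ) (x : L₀), ((τ i x : L₀) : AlgebraicClosure (v.adicCompletion ℚ)) =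
      (g ^ i) • (x : AlgebraicClosure (v.adicCompletion ℚ)) := fun i x ↦ by exact hr i x
  -- injectivity of `i ↦ τ i` on `i < p^w`: `g^i`, `g^j` agreeing on `L₀` forces `g^{j−i} ∈ fixingSubgroup L₀ = H_{m+w}`
  have key : ∀ i j : Fin (p ^ w), (∀ x : L₀, (g ^ (i : ℕ)) • (x : AlgebraicClosure (v.adicCompletion ℚ)) =
      (g ^ (j : ℕ)) • (x : AlgebraicClosure (v.adicCompletion ℚ))) → (i : ℕ) ≤ j → i = j := by
    intro i j hagree hle
    have hmem : g ^ ((j : ℕ) - i) ∈ Hmw := by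
      refine (keyfix _).mp ((IntermediateField.mem_fixingSubgroup_iff L₀ _).mpr fun x hx ↦ ?_)
      change (g ^ ((j : ℕ) - i)) • x = x
      have h1 := hagree ⟨x, hx⟩
      have h2 : g ^ (j : ℕ) = g ^ (i : ℕ) * g ^ ((j : ℕ) - i) := by rw [← pow_add, Nat.add_sub_cancel' hle]
      rw [h2, mul_smul] at h1
      exact (smul_left_cancel_iff (g ^ (i : ℕ))).mp h1.symm
    rw [hpowmem] at hmem
    have hlt : (j : ℕ) - i < p ^ w := by omega
    have h0 : (j : ℕ) - i = 0 := Nat.eq_zero_of_dvd_of_lt hmem hlt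
    exact Fin.ext (by omega)
  have hinj : Function.Injective (fun i : Fin (p ^ w) ↦ τ i) := by
    intro i j hij
    have hagree : ∀ x : L₀, (g ^ (i : ℕ)) • (x : AlgebraicClosure (v.adicCompletion ℚ)) =
        (g ^ (j : ℕ)) • (x : AlgebraicClosure (v.adicCompletion ℚ)) := fun x ↦ by
      rw [← hτ, ← hτ]
      exact congrArg (fun σ : L₀ ≃ₐ[K₀] L₀ ↦ ((σ x : L₀) : AlgebraicClosure (v.adicCompletion ℚ))) hij
    rcases le_total (i : ℕ) j with hle | hle
    · exact key i j hagree hle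
    · exact (key j i (fun x ↦ (hagree x).symm) hle).symm
  have hcardGal : Fintype.card (L₀ ≃ₐ[K₀] L₀) = p ^ w := by
    rw [← Nat.card_eq_fintype_card, IsGalois.card_aut_eq_finrank, hrk]
  have hbij : Function.Bijective (fun i : Fin (p ^ w) ↦ τ i) := by
    rw [Fintype.bijective_iff_injective_and_card]
    exact ⟨hinj, by rw [Fintype.card_fin, hcardGal]⟩
  have hnormz : ((Algebra.norm K₀ (z : L₀) : K₀) : AlgebraicClosure (v.adicCompletion ℚ)) =
      ∏ i ∈ Finset.range (p ^ w), (g ^ i) • ((z : L₀) : AlgebraicClosure (v.adicCompletion ℚ)) := by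
    have hprod := Algebra.norm_eq_prod_automorphisms K₀ (z : L₀)
    have h1 : ((Algebra.norm K₀ (z : L₀) : K₀) : AlgebraicClosure (v.adicCompletion ℚ)) =
        ((algebraMap K₀ L₀ (Algebra.norm K₀ (z : L₀)) : L₀) : AlgebraicClosure (v.adicCompletion ℚ)) :=
      (LocalWeilDatum.towerAlgebra_algebraMap_apply hKL _).symm
    rw [h1, hprod, IntermediateField.coe_prod,
      ← hbij.prod_comp (fun σ : L₀ ≃ₐ[K₀] L₀ ↦ ((σ (z : L₀) : L₀) : AlgebraicClosure (v.adicCompletion ℚ))),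
      ← Fin.prod_univ_eq_prod_range (fun i ↦ (g ^ i) • ((z : L₀) : AlgebraicClosure (v.adicCompletion ℚ))) (p ^ w)]
    exact Finset.prod_congr rfl fun i _ ↦ hτ i (z : L₀)
  -- the witness
  have hz0 : ((z : L₀) : AlgebraicClosure (v.adicCompletion ℚ)) ≠ 0 := fun h0 ↦ z.ne_zero (Subtype.ext h0)
  refine ⟨Units.mk0 _ hz0, fun h hh ↦ ?_, ?_⟩
  · rw [Units.val_mk0]
    exact memL.mp (z : L₀).2 h hh
  · rw [Units.val_mk0, ← hnormz]
    have h1 := congrArg (fun u : K₀ˣ ↦ ((u : K₀) : AlgebraicClosure (v.adicCompletion ℚ))) hz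
    simp only [hNKL, Units.coe_map, hy, Units.val_mk0] at h1
    rw [h1]
    rfl

end Literature.NumberTheory.EllipticCurves.Greenberg1999.MultTowerSplitExact

end Part1

/-!
## Part 2 — port of `Summits/BirchSwinnertonDyer/BirchSwinnertonDyer/Theorems/ByReductionTypeAtTwoMultTowerSplitOrderTransport.lean`

# Route `ByReductionTypeAtTwo`, crux `MultUpperHalfAtTwo` (item stmt-BirchSwinnertonDyer-19922), TOWER road, the
# SPLIT rows: KERNEL BRICK S3 — the UNTWISTED Tate uniformisation at a split prime WITH its `j`-clause, the
# identification `padicEquiv_v(q_v) = q_E` with the Tate parameter of a `TateParameterData`, and the transport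
# `M_∞ = E(K̄_v)^{H_∞} = Φ(K̄_v^{H_∞})`

HONEST FRAMING (cell `bsd-2adic`, run/shared/lean/pub/bsd-2adic/, seat `bsd-2adic-mult` GEN 13, HUMAN RULINGS
D-0036 / D-0054 / D-0074): TOOL theorems only (no definition, no named fact, no `sorry`); closes nothing by itself;
nothing booked; BSD is not proved by any of this. Third brick of the KERNEL proof of the projection of the PRINT named
fact `Greenberg1999.sec3_natCard_localTowerKerPrimary_splitMultiplicative_rat` consumed by the split TOWER doors
(`MultTowerCert.atTwo_le_pow_of_split`, whose certificate is stated on `Dq : TateParameterData W 2`, i.e. on THE Tate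
parameter `q_E ∈ ℚ₂` with `tateJ q_E = j(E)`). Everything here holds at EVERY prime `p`.

* `tateE4_map` / `tateDelta_map` / `tateJ_map` — the `q`-expansions commute with a bicontinuous ring isomorphism
  (Mathlib `Function.LeftInverse.map_tsum` / `map_tprod`);
* `norm_padicEquiv_lt_one` — Mathlib's `padicEquiv v : ℚ_v ≃A[ℚ] ℚ_p` maps `{‖q‖ < 1}` into `{‖·‖ < 1}`
  (it identifies the unit balls, `adicCompletion.padicEquiv_bijOn`);
* `exists_tateUniformisation_tateJ` — **Silverman ATAEC V.3.1 (c)(d) + V.5.3 at a SPLIT place, untwisted, with the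
  `j`-clause**: `q ∈ ℚ_v`, `q ≠ 0`, `‖q‖ < 1`, `tateJ q = j(W)`, `Φ : K̄_vˣ ↠ E(K̄_v)` with kernel `q^ℤ` and
  `σ • Φ(u) = Φ(σu)` (the tree's `Silverman1994_thmV53_tateUniformisation_holds` keeps everything but the `j`-clause;
  same assembly from `exists_tateParameter_of_hasSplitMultiplicativeReductionAt` + `uniformization_holds`);
* `padicEquiv_eq_tateParameter` — **`padicEquiv_v(q) = Dq.q`** for `v ∋ p` and `Dq : TateParameterData W p` (Tate
  parameter uniqueness `eq_of_tateJ_eq` in `ℚ_p`, ATAEC Lemma V.5.1);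
* `exists_unit_of_mem_fixedPoints_split` / `apply_mem_fixedPoints_split` — `M_∞ = Φ({x : ∀ h ∈ H_∞, hx = x})`
  (orbit finiteness, tower-1's `smul_eq_self_of_smul_eq_zpow_mul`; untwisted form of tower-1's BRICK 18).

References: J. Silverman, GTM 151, Lemma V.5.1, Thm. V.3.1 (c)(d), Thm. V.5.3; R. Greenberg, LNM 1716 (1999), §3
pp. 90–93; cell memo HOME/mult/NOTE-SP1ONE.md §5.
-/

section Part2

set_option autoImplicit false

open scoped _root_.Classical

namespace Literature.NumberTheory.EllipticCurves.Greenberg1999.MultTowerSplitOrder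

open _root_.NumberField _root_.IsDedekindDomain _root_.Field _root_.WeierstrassCurve _root_.Rat.HeightOneSpectrum
  Literature.NumberTheory.EllipticCurves Literature.NumberTheory.EllipticCurves.TateCurve
  Literature.NumberTheory.GaloisRepresentations
  Literature.NumberTheory.EllipticCurves.Greenberg1999.MultTowerNS2

/-! ### The `q`-expansions commute with bicontinuous ring isomorphisms -/

section MapSeries

variable {K L : Type*} [NormedField K] [NormedField L]

/-- `E₄(e q) = e(E₄(q))` for a bicontinuous ring isomorphism `e`. [folklore] -/
private theorem tateE4_map (e : K ≃+* L) (he : Continuous e) (he' : Continuous e.symm) (q : K) :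
    tateE4 (e q) = e (tateE4 q) := by
  unfold tateE4
  rw [map_add, map_one, map_mul, map_ofNat,
    Function.LeftInverse.map_tsum (fun n : ℕ ↦ ((ArithmeticFunction.sigma 3 (n + 1) : ℕ) : K) * q ^ (n + 1))
      he he' e.symm_apply_apply]
  congr 2
  refine tsum_congr fun n ↦ ?_
  rw [map_mul, map_natCast, map_pow]

/-- `Δ(e q) = e(Δ(q))` for a bicontinuous ring isomorphism `e`. [folklore] -/
private theorem tateDelta_map (e : K ≃+* L) (he : Continuous e) (he' : Continuous e.symm) (q : K) :
    tateDelta (e q) = e (tateDelta q) := by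
  unfold tateDelta
  rw [map_mul, Function.LeftInverse.map_tprod (fun n : ℕ ↦ (1 - q ^ (n + 1)) ^ 24) he he' e.symm_apply_apply]
  congr 1
  refine tprod_congr fun n ↦ ?_
  rw [map_pow, map_sub, map_one, map_pow]

/-- `j(e q) = e(j(q))` for a bicontinuous ring isomorphism `e`. [folklore] -/
private theorem tateJ_map (e : K ≃+* L) (he : Continuous e) (he' : Continuous e.symm) (q : K) :
    tateJ (e q) = e (tateJ q) := by
  unfold tateJ
  rw [tateE4_map e he he', tateDelta_map e he he', map_div₀, map_pow]

end MapSeries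

/-! ### Mathlib's `padicEquiv` on the open unit ball -/

/-- **`‖q‖ < 1 ⇒ ‖padicEquiv_v q‖ < 1`**: `padicEquiv v` identifies the unit balls `𝒪_v` and `ℤ_p`
(`adicCompletion.padicEquiv_bijOn`); an element of norm `< 1` with image a unit would have its inverse in `𝒪_v`.
[folklore] -/
private theorem norm_padicEquiv_lt_one (v : HeightOneSpectrum (𝓞 ℚ)) {q : v.adicCompletion ℚ} (hq0 : q ≠ 0)
    (hq : ‖q‖ < 1) :
    haveI := Fact.mk (primesEquiv v).2
    ‖(adicCompletion.padicEquiv (R := 𝓞 ℚ) v) q‖ < 1 := by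
  haveI := Fact.mk (primesEquiv v).2
  have hbij := adicCompletion.padicEquiv_bijOn (R := 𝓞 ℚ) v
  have hint : ∀ x : v.adicCompletion ℚ, ‖x‖ ≤ 1 → ‖(adicCompletion.padicEquiv (R := 𝓞 ℚ) v) x‖ ≤ 1 := by
    intro x hx
    have hx' : x ∈ v.adicCompletionIntegers ℚ :=
      (HeightOneSpectrum.mem_adicCompletionIntegers (𝓞 ℚ) ℚ v).mpr
        ((Valued.toNormedField.norm_le_one_iff).mp hx)
    exact (hbij.1 hx' : _ ∈ PadicInt.subring _)
  have hle := hint q hq.le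
  rcases lt_or_eq_of_le hle with h | h
  · exact h
  · exfalso
    -- the image is a unit of `ℤ_p`, so `q⁻¹ ∈ 𝒪_v`, contradicting `‖q‖ < 1`
    set Q := (adicCompletion.padicEquiv (R := 𝓞 ℚ) v) q with hQ
    have hQ0 : Q ≠ 0 := by rw [hQ]; exact (map_ne_zero _).mpr hq0
    have hQi : ‖Q⁻¹‖ ≤ 1 := by rw [norm_inv, h, inv_one]
    have hmem : Q⁻¹ ∈ PadicInt.subring (primesEquiv v : ℕ) := hQi
    obtain ⟨y, hy, hyQ⟩ := hbij.2.2 hmem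
    have hyq : y = q⁻¹ := by
      have h' : (adicCompletion.padicEquiv (R := 𝓞 ℚ) v) y = (adicCompletion.padicEquiv (R := 𝓞 ℚ) v) q⁻¹ := by
        rw [hyQ, hQ, map_inv₀]
      exact (adicCompletion.padicEquiv (R := 𝓞 ℚ) v).injective h'
    have hqi : ‖q⁻¹‖ ≤ 1 := by
      rw [← hyq]
      exact (Valued.toNormedField.norm_le_one_iff).mpr
        ((HeightOneSpectrum.mem_adicCompletionIntegers (𝓞 ℚ) ℚ v).mp hy)
    rw [norm_inv] at hqi
    have h1 : 1 ≤ ‖q‖ := by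
      by_contra hlt
      push Not at hlt
      have hpos : 0 < ‖q‖ := norm_pos_iff.mpr hq0
      have : 1 < ‖q‖⁻¹ := (one_lt_inv₀ hpos).mpr hlt
      linarith
    linarith

/-! ### The untwisted Tate uniformisation with its `j`-clause -/

/-- **Silverman ATAEC Thm. V.3.1 (c)(d) + Thm. V.5.3 at a place of SPLIT multiplicative reduction, untwisted, WITH
the `j`-clause.** For `W/ℚ` elliptic with split multiplicative reduction at the finite place `v`: there are `q ∈ ℚ_v`
with `q ≠ 0`, `‖q‖ < 1`, `tateJ q = j(W)`, and a surjective homomorphism `Φ : K̄_vˣ → E(K̄_v)` with kernel `q^ℤ`,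
`Γ_{ℚ_v}`-equivariant (`σ • Φ(u) = Φ(σu)`). Same assembly as the tree's `Silverman1994_thmV53_tateUniformisation_holds`
(which discards the `j`-clause): `exists_tateParameter_of_hasSplitMultiplicativeReductionAt` + `uniformization_holds`
+ `localPointsEquivTate`. [cite: SilvermanATAEC1994, Thm. V.5.3 (PDF pp. 407–409) and Thm. V.3.1 (c)(d) (PDF p. 395)] -/
theorem exists_tateUniformisation_tateJ (W : WeierstrassCurve ℚ) [W.IsElliptic] (v : HeightOneSpectrum (𝓞 ℚ))
    (hsplit : W.HasSplitMultiplicativeReductionAt v) :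
    ∃ (q : v.adicCompletion ℚ)
      (Φ : Additive (AlgebraicClosure (v.adicCompletion ℚ))ˣ →+ localPoints W (v.adicCompletion ℚ)),
      q ≠ 0 ∧ ‖q‖ < 1 ∧ tateJ q = algebraMap ℚ (v.adicCompletion ℚ) W.j ∧
      Function.Surjective Φ ∧
      (∀ u : (AlgebraicClosure (v.adicCompletion ℚ))ˣ, Φ (Additive.ofMul u) = 0 ↔
        ∃ n : ℤ, (u : AlgebraicClosure (v.adicCompletion ℚ)) =
          algebraMap (v.adicCompletion ℚ) (AlgebraicClosure (v.adicCompletion ℚ)) q ^ n) ∧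
      (∀ (σ : absoluteGaloisGroup (v.adicCompletion ℚ)) (u : (AlgebraicClosure (v.adicCompletion ℚ))ˣ),
        σ • Φ (Additive.ofMul u) =
          Φ (Additive.ofMul (Units.map
            (absoluteGaloisGroup.toAlgEquiv (v.adicCompletion ℚ) σ :
              AlgebraicClosure (v.adicCompletion ℚ) →* AlgebraicClosure (v.adicCompletion ℚ)) u))) := by
  haveI := charZero_adicCompletion' ℚ v
  obtain ⟨q, hq0, hq, hqj, -, C, hC⟩ := exists_tateParameter_of_hasSplitMultiplicativeReductionAt ℚ v W hsplit
  -- (port: proof-local replacement of the original's section-wide instance declaration)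
  letI := Literature.NumberTheory.GaloisRepresentations.Ultrametric.AdicCompletion.nontriviallyNormedField ℚ v
  obtain ⟨φ, hsurj, hker, hequiv, -⟩ := uniformization_holds q hq0 hq
  let e := localPointsEquivTate W v C hC
  refine ⟨q, e.symm.toAddMonoidHom.comp φ, hq0, hq, hqj, e.symm.surjective.comp hsurj, ?_, ?_⟩
  · intro u
    rw [← hker u]
    change e.symm (φ (Additive.ofMul u)) = 0 ↔ _
    rw [AddEquiv.map_eq_zero_iff]
  · intro σ u
    change σ • e.symm (φ (Additive.ofMul u)) = e.symm (φ _)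
    rw [← hequiv σ u]
    apply e.injective
    rw [AddEquiv.apply_symm_apply, localPointsEquivTate_smul, AddEquiv.apply_symm_apply]

/-! ### `padicEquiv_v(q) = q_E` -/

/-- **The local Tate parameter IS the Tate parameter of the datum.** For `v ∋ p`, `q ∈ ℚ_v` with `q ≠ 0`, `‖q‖ < 1`,
`tateJ q = j(W)`, and `Dq : TateParameterData W p` (`p = primesEquiv v`): `padicEquiv_v(q) = Dq.q` in `ℚ_p` —
`padicEquiv_v` is a bicontinuous `ℚ`-algebra isomorphism, so `tateJ(padicEquiv_v q) = padicEquiv_v(tateJ q) = j(W)` and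
`‖padicEquiv_v q‖ < 1`; conclude by the uniqueness of the Tate parameter (ATAEC Lemma V.5.1, the tree's
`eq_of_tateJ_eq`). [cite: SilvermanATAEC1994, Lemma V.5.1 (PDF p. 406)] -/
theorem padicEquiv_eq_tateParameter (W : WeierstrassCurve ℚ) [W.IsElliptic] (v : HeightOneSpectrum (𝓞 ℚ))
    {q : v.adicCompletion ℚ} (hq0 : q ≠ 0) (hq : ‖q‖ < 1)
    (hqj : tateJ q = algebraMap ℚ (v.adicCompletion ℚ) W.j) :
    haveI := Fact.mk (primesEquiv v).2
    ∀ Dq : TateParameterData W (primesEquiv v : ℕ), (adicCompletion.padicEquiv (R := 𝓞 ℚ) v) q = Dq.q := by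
  haveI := Fact.mk (primesEquiv v).2
  intro Dq
  set e := adicCompletion.padicEquiv (R := 𝓞 ℚ) v with he
  have hQ0 : e q ≠ 0 := (map_ne_zero _).mpr hq0
  have hQ1 : ‖e q‖ < 1 := norm_padicEquiv_lt_one v hq0 hq
  have hQj : tateJ (e q) = (W.j : ℚ_[(primesEquiv v : ℕ)]) := by
    have h := tateJ_map (e : v.adicCompletion ℚ ≃A[ℚ] ℚ_[(primesEquiv v : ℕ)]).toAlgEquiv.toRingEquiv
      e.continuous e.symm.continuous q
    change tateJ (e q) = e.toAlgEquiv.toRingEquiv (tateJ q) at h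
    rw [h, hqj]
    change e.toAlgEquiv (algebraMap ℚ (v.adicCompletion ℚ) W.j) = _
    rw [AlgEquiv.commutes, eq_ratCast]
  exact eq_of_tateJ_eq hQ0 hQ1 Dq.q_ne_zero Dq.norm_q_lt_one (hQj.trans Dq.tateJ_eq.symm)

/-! ### Transport: `M_∞ = Φ(K̄_v^{H_∞})` -/

section Transport

variable {p : ℕ} [Fact p.Prime] {κ : ZpExtension ℚ p} (v : HeightOneSpectrum (𝓞 ℚ)) {W : WeierstrassCurve ℚ}
  {Φ : Additive (AlgebraicClosure (v.adicCompletion ℚ))ˣ →+ localPoints W (v.adicCompletion ℚ)}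
  {Q : AlgebraicClosure (v.adicCompletion ℚ)}

/-- **`M_∞ ⊆ Φ(K̄_v^{H_∞})`** (untwisted): a point of `E(K̄_v)` fixed by `H_∞` is `Φ(x)` with `x` fixed by `H_∞` —
`Φ(x) = hΦ(x) = Φ(hx)` gives `hx = Q^j x`, and `hx = x` by orbit finiteness. [cite: GreenbergLNM1716, §3 (pp. 90–93)]
[cite: SilvermanATAEC1994, Thm. V.3.1 (c)(d), Thm. V.5.3] -/
theorem exists_unit_of_mem_fixedPoints_split (hsurj : Function.Surjective Φ)
    (hker : ∀ u : (AlgebraicClosure (v.adicCompletion ℚ))ˣ, Φ (Additive.ofMul u) = 0 ↔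
      ∃ j : ℤ, (u : AlgebraicClosure (v.adicCompletion ℚ)) = Q ^ j)
    (hequiv : ∀ (σ : absoluteGaloisGroup (v.adicCompletion ℚ)) (u u' : (AlgebraicClosure (v.adicCompletion ℚ))ˣ),
      (u' : AlgebraicClosure (v.adicCompletion ℚ)) = σ • (u : AlgebraicClosure (v.adicCompletion ℚ)) →
        σ • Φ (Additive.ofMul u) = Φ (Additive.ofMul u'))
    (hQfix : ∀ σ : absoluteGaloisGroup (v.adicCompletion ℚ), σ • Q = Q) (hQ0 : Q ≠ 0)
    (hQtor : ∀ j : ℤ, Q ^ j = 1 → j = 0)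
    {m : localPoints W (v.adicCompletion ℚ)}
    (hm : ∀ h ∈ localSubgroup κ.kerSubgroup (v.adicCompletion ℚ), h • m = m) :
    ∃ x : (AlgebraicClosure (v.adicCompletion ℚ))ˣ, Φ (Additive.ofMul x) = m ∧
      ∀ h ∈ localSubgroup κ.kerSubgroup (v.adicCompletion ℚ),
        h • (x : AlgebraicClosure (v.adicCompletion ℚ)) = x := by
  obtain ⟨x', hx'⟩ := hsurj m
  set x : (AlgebraicClosure (v.adicCompletion ℚ))ˣ := Additive.toMul x' with hx
  have hxm : Φ (Additive.ofMul x) = m := by rw [hx, ofMul_toMul]; exact hx'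
  refine ⟨x, hxm, fun h hh ↦ ?_⟩
  set u' : (AlgebraicClosure (v.adicCompletion ℚ))ˣ :=
    Units.mk0 (h • (x : AlgebraicClosure (v.adicCompletion ℚ))) ((smul_ne_zero_iff_ne h).mpr x.ne_zero) with hu'
  have h1 := hequiv h x u' rfl
  rw [hxm, hm h hh] at h1
  -- `Φ x = Φ (h x)`: `h x = Q^j x`
  rw [← hxm, tatePsi_eq_iff v hker] at h1
  obtain ⟨j, hj⟩ := h1
  have hj' : h • (x : AlgebraicClosure (v.adicCompletion ℚ)) = Q ^ (-j) * x := by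
    rw [zpow_neg, ← Units.val_mk0 ((smul_ne_zero_iff_ne h).mpr x.ne_zero), ← hu', hj]
    field_simp
  exact smul_eq_self_of_smul_eq_zpow_mul v (hQfix h) hQ0 hQtor x.ne_zero hj'

/-- **`Φ(K̄_v^{H}) ⊆ E(K̄_v)^{H}`** (untwisted, any subgroup `H`): if `x` is fixed by `H` then so is `Φ(x)`.
[cite: SilvermanATAEC1994, Thm. V.3.1 (c)(d), Thm. V.5.3] -/
theorem apply_mem_fixedPoints_split
    (hequiv : ∀ (σ : absoluteGaloisGroup (v.adicCompletion ℚ)) (u u' : (AlgebraicClosure (v.adicCompletion ℚ))ˣ),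
      (u' : AlgebraicClosure (v.adicCompletion ℚ)) = σ • (u : AlgebraicClosure (v.adicCompletion ℚ)) →
        σ • Φ (Additive.ofMul u) = Φ (Additive.ofMul u'))
    (H : Subgroup (absoluteGaloisGroup (v.adicCompletion ℚ)))
    {x : (AlgebraicClosure (v.adicCompletion ℚ))ˣ}
    (hx : ∀ h ∈ H, h • (x : AlgebraicClosure (v.adicCompletion ℚ)) = x) :
    ∀ h ∈ H, h • Φ (Additive.ofMul x) = Φ (Additive.ofMul x) :=
  fun h hh ↦ hequiv h x x (hx h hh).symm

end Transport

end Literature.NumberTheory.EllipticCurves.Greenberg1999.MultTowerSplitOrder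

end Part2

/-!
## Part 3 — port of `Summits/BirchSwinnertonDyer/BirchSwinnertonDyer/Theorems/ByReductionTypeAtTwoGoodOrdTowerHensel.lean`

# Route `ByReductionTypeAtTwo`, item `OrdKatoHalfAtTwo` (stmt-BirchSwinnertonDyer-19271), TOWER road, the
# GOOD-ORDINARY local constant at `v ∣ p`: KERNEL BRICK G4 — the arithmetic inputs of the dévissage (inertial
# generator, reduction is inertia-invariant, Hensel lifts of Frobenius-fixed reductions, `#Ẽ(k̄)[p] ≤ p`)

HONEST FRAMING (cell `bsd-2adic`, run/shared/lean/pub/bsd-2adic/, seat `bsd-2adic-tower-1` GEN 11, HUMAN RULINGS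
D-0036 / D-0054 / D-0074): TOOL theorems only (no definition, no named fact, no `sorry`); closes nothing by itself;
nothing booked; BSD is not proved by any of this. Step S1 of the KERNELISATION of the consumed projection
`#𝒦_{v,n}[2^∞][2] ≤ 4` of the PRINT binder `hS34 = Greenberg1999.lemma34_localTowerKerPrimary_cyclicExtension_rat`
(scope memo HOME/tower/SCOPE-hS34-layer-kernel-at-2-GEN7.md §1, §3): the hypotheses `hrD` / `hlift` / `#T[p]` of BRICK G1
(`GoodOrdTower.natCard_torsionBy_quotient_le_of_invariant`) for `M = E(K̄_v)^{H_∞}`, `D = g − 1`, `r = red₀`, in the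
setting and vocabulary of `OrdinaryLocalReductionMapProofs` (`W/ℚ` globally minimal, `v ∋ p`, spectral valuation `w`,
`red₀ : E(K̄_v) → Ẽ(k̄_w)` the reduction of the local integral model).

* `exists_inertial_generator` — a topological generator `g` of `H_n` over `H_∞` lying in the INERTIA group `I_{ℚ_v}`
  (GEN 8 `MultTowerNS2.exists_mem_absInertia_mem_localSubgroup_kerSubgroup` + `ZpExtension.exists_mem_localSubgroup_generate`);
* `localRed_smul_eq_of_mem_absInertia` — **`red₀ (g • Q) = red₀ Q` for `g ∈ I_{ℚ_v}`** (inertia fixes the prime-to-`p` roots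
  of unity, `mem_absInertia_iff_smul_rootsOfUnity`; `exists_layer_localRed_smul_eq`);
* `exists_fixed_localRed_eq` — **Hensel**: a point `Q ∈ E(K̄_v)` whose reduction is fixed by the arithmetic Frobenius `τ`
  (`red₀ (τ • Q) = red₀ Q`) has the same reduction as some `ℚ_v`-RATIONAL point `P₀` (`σ • P₀ = P₀` for all `σ`): the
  coordinates of `red₀ Q` satisfy `x̄^q = x̄`, so lie in `𝔽_v` (`residueMap_pow_eq_of_reducePoint_smul_eq`), and the
  `𝔽_v`-point lifts to `E(ℚ_v)` by Hensel's lemma over `ℤ_v` (`WeierstrassCurve.exists_equation_residue_eq`, AEC VII.2.1);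
* `finite_torsionBy_localRed_target`, `natCard_torsionBy_localRed_target_le` — at a good ORDINARY `v ∣ p`:
  `#Ẽ(k̄_w)[p] ≤ p` (`red₀ : E[p] ↠ Ẽ[p]` with kernel of order `p`, `#E[p] = p²`; `localRed_ordinary_filtration`).

References: J. Silverman, *AEC* (2009), VII.2.1, VII.3.1, III.6.4; R. Greenberg, LNM 1716 (1999), §1 p. 62, §2 pp. 69–70;
L. Washington, *Cyclotomic Fields*, §13.1; scope memo §1, §3.
-/

section Part3

set_option autoImplicit false

open scoped _root_.Classical _root_.NNReal ValuativeRel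

namespace Literature.NumberTheory.EllipticCurves.Greenberg1999.GoodOrdTower

open _root_.NumberField _root_.IsDedekindDomain _root_.Field _root_.Polynomial Literature.NumberTheory.EllipticCurves
  Literature.NumberTheory.GaloisRepresentations _root_.IsDedekindDomain.HeightOneSpectrum
  Literature.NumberTheory.EllipticCurves.FormalGroupChart _root_.WeierstrassCurve

variable {p : ℕ} [hp : Fact p.Prime] {κ : ZpExtension ℚ p}

/-! ## §A An inertial topological generator of `H_n` over `H_∞` -/

/-- **An inertial topological generator of the layer**: for the cyclotomic `ℤ_p`-extension `κ` and `v ∋ p` there is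
`g` in the inertia group `I_{ℚ_v}` lying in `H_n = localSubgroup (κ.layerSubgroup n) ℚ_v` such that every open
subgroup containing `H_∞ = localSubgroup κ.kerSubgroup ℚ_v` and `g` contains `H_n` (`ℚ_v(μ_{p^∞})/ℚ_v` is totally
ramified: `Γ = I · H_∞`). [cite: Washington1997, §13.1] -/
theorem exists_inertial_generator (hκ : κ.IsCyclotomic) (v : HeightOneSpectrum (𝓞 ℚ))
    (hv : (p : 𝓞 ℚ) ∈ v.asIdeal) (n : ℕ) :
    ∃ g : absoluteGaloisGroup (v.adicCompletion ℚ), g ∈ absInertia (v.adicCompletion ℚ) ∧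
      g ∈ localSubgroup (κ.layerSubgroup n) (v.adicCompletion ℚ) ∧
      ∀ U : Subgroup (absoluteGaloisGroup (v.adicCompletion ℚ)),
        IsOpen (U : Set (absoluteGaloisGroup (v.adicCompletion ℚ))) →
          localSubgroup κ.kerSubgroup (v.adicCompletion ℚ) ≤ U → g ∈ U →
            localSubgroup (κ.layerSubgroup n) (v.adicCompletion ℚ) ≤ U := by
  obtain ⟨g₀, hg₀, hgen₀⟩ := ZpExtension.exists_mem_localSubgroup_generate κ (v.adicCompletion ℚ) n
  obtain ⟨τ, hτI, hτ⟩ := MultTowerNS2.exists_mem_absInertia_mem_localSubgroup_kerSubgroup hκ v hv g₀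
  have hle : localSubgroup κ.kerSubgroup (v.adicCompletion ℚ) ≤
      localSubgroup (κ.layerSubgroup n) (v.adicCompletion ℚ) := fun σ hσ ↦
    (mem_localSubgroup_iff _ _ _).mpr (κ.kerSubgroup_le_layerSubgroup n ((mem_localSubgroup_iff _ _ _).mp hσ))
  refine ⟨τ, hτI, ?_, fun U hU hHU hτU ↦ hgen₀ U hU hHU ?_⟩
  · have h : τ = g₀ * (τ⁻¹ * g₀)⁻¹ := by group
    rw [h]
    exact mul_mem hg₀ (inv_mem (hle hτ))
  · have h : g₀ = τ * (τ⁻¹ * g₀) := by group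
    rw [h]
    exact mul_mem hτU (hHU hτ)

/-! ## §B The reduction map is inertia-invariant -/

variable (W : WeierstrassCurve ℚ) [W.IsGloballyMinimal] {v : HeightOneSpectrum (𝓞 ℚ)}
  {w : Valuation (AlgebraicClosure (v.adicCompletion ℚ)) ℝ≥0}
  (hw : ∀ x, (w x : ℝ) = spectralNorm (v.adicCompletion ℚ) (AlgebraicClosure (v.adicCompletion ℚ)) x)
  (hΔu : IsUnit ((integralModelInt W).map (algebraMap ℤ ↥w.valuationSubring)).Δ)
  (red₀ : localPoints W (v.adicCompletion ℚ) →+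
    (((integralModelInt W).map (algebraMap ℤ ↥w.valuationSubring)).map
      (IsLocalRing.residue ↥w.valuationSubring)).toAffine.Point)
  (hred₀ : ∀ P : localPoints W (v.adicCompletion ℚ), red₀ P =
    ((integralModelInt W).map (algebraMap ℤ ↥w.valuationSubring)).reducePoint
      (Affine.Point.congrEquiv (localIntModel_baseChange W w.valuationSubring).symm P))

include hw hred₀ in
/-- **`red₀ (g • Q) = red₀ Q` for `g` in the inertia group** (`v ∋ p`, `𝔐` a prime of `𝒪_{K̄_v}` over `v`): the inertia
group fixes every root of unity of order prime to `p` (`mem_absInertia_iff_smul_rootsOfUnity`), in particular a primitive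
`(q^f − 1)`-th one, and every `σ` fixing such a root with `f` large does not move the reduction of `Q`
(`exists_layer_localRed_smul_eq`, Serre *Local Fields* II §4 Prop. 8). [cite: SerreLocalFields1979, Ch. II §4 Prop. 8] -/
theorem localRed_smul_eq_of_mem_absInertia (hpv : (p : 𝓞 ℚ) ∈ v.asIdeal) {𝔐 : Ideal v.localAbsIntegers}
    (h𝔐 : 𝔐 ∈ v.localPrimesAbove) {g : absoluteGaloisGroup (v.adicCompletion ℚ)}
    (hg : g ∈ absInertia (v.adicCompletion ℚ)) (Q : localPoints W (v.adicCompletion ℚ)) :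
    red₀ (g • Q) = red₀ Q := by
  obtain ⟨f, hf, hlayer⟩ := W.exists_layer_localRed_smul_eq hw red₀ hred₀ h𝔐 {Q}
  -- `q = p`
  have hq : Nat.card (IsLocalRing.ResidueField (v.adicCompletionIntegers ℚ)) = p := by
    rw [natCard_residueField_adicCompletionIntegers v, Rat.HeightOneSpectrum.primesEquiv_eq_of_natCast_mem v hp.out hpv]
  rw [hq] at hlayer
  -- a primitive `(p^f - 1)`-th root of unity of `K̄_v`
  have hN0 : p ^ f - 1 ≠ 0 := (Nat.sub_pos_of_lt (Nat.one_lt_pow hf hp.out.one_lt)).ne'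
  haveI : CharZero (AlgebraicClosure (v.adicCompletion ℚ)) :=
    charZero_of_injective_algebraMap (algebraMap ℚ (AlgebraicClosure (v.adicCompletion ℚ))).injective
  haveI : NeZero ((p ^ f - 1 : ℕ) : AlgebraicClosure (v.adicCompletion ℚ)) := ⟨Nat.cast_ne_zero.mpr hN0⟩
  obtain ⟨ζ, hζ⟩ := HasEnoughRootsOfUnity.prim (M := AlgebraicClosure (v.adicCompletion ℚ)) (n := p ^ f - 1)
  -- inertia fixes it: `p ∤ p^f - 1`
  have hunit : IsUnit ((p ^ f - 1 : ℕ) : 𝒪[v.adicCompletion ℚ]) := by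
    have hcop : ¬ p ∣ p ^ f - 1 := by
      intro h
      have h1 : p ∣ p ^ f := dvd_pow_self p hf
      have h2 : p ∣ p ^ f - (p ^ f - 1) := Nat.dvd_sub h1 h
      rw [Nat.sub_sub_self (Nat.one_le_pow f p hp.out.pos)] at h2
      exact hp.out.one_lt.ne' (Nat.dvd_one.mp h2)
    have hw1 : w (algebraMap (v.adicCompletion ℚ) (AlgebraicClosure (v.adicCompletion ℚ))
        ((p ^ f - 1 : ℕ) : v.adicCompletion ℚ)) = 1 := by
      rw [map_natCast]
      exact spectralValuation_natCast_eq_one_of_not_dvd hpv hw hcop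
    have hnorm : ‖((p ^ f - 1 : ℕ) : v.adicCompletion ℚ)‖ = 1 := by
      have h := hw (algebraMap (v.adicCompletion ℚ) (AlgebraicClosure (v.adicCompletion ℚ))
        ((p ^ f - 1 : ℕ) : v.adicCompletion ℚ))
      rw [spectralNorm_extends, hw1, NNReal.coe_one] at h
      exact h.symm
    rw [(Valuation.integer.integers (ValuativeRel.valuation (v.adicCompletion ℚ))).isUnit_iff_valuation_eq_one]
    change ValuativeRel.valuation (v.adicCompletion ℚ) (((p ^ f - 1 : ℕ) : 𝒪[v.adicCompletion ℚ]) : v.adicCompletion ℚ) = 1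
    rw [show (((p ^ f - 1 : ℕ) : 𝒪[v.adicCompletion ℚ]) : v.adicCompletion ℚ) =
      ((p ^ f - 1 : ℕ) : v.adicCompletion ℚ) from by simp]
    refine le_antisymm ((adicCompletion_valuation_le_one_iff ℚ v _).mpr hnorm.le) (not_lt.mp fun hlt ↦ ?_)
    exact absurd hnorm (ne_of_lt ((adicCompletion_valuation_lt_one_iff ℚ v _).mp hlt))
  have hgζ : g • ζ = ζ :=
    (mem_absInertia_iff_smul_rootsOfUnity.mp hg) (p ^ f - 1) hunit ζ hζ.pow_eq_one
  exact hlayer ζ hζ g hgζ Q (Finset.mem_singleton_self Q)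


variable [W.IsElliptic]

/-! ## §C Hensel: Frobenius-fixed reductions come from `ℚ_v`-rational points -/

include hw hΔu hred₀ in
/-- **Hensel lift of a Frobenius-fixed reduction.** For `W/ℚ` globally minimal with `p ∤ Δ_W`, `v ∋ p`, an arithmetic
Frobenius `τ` at a prime `𝔐` of `𝒪_{K̄_v}` over `v`, and a point `Q ∈ E(K̄_v)` with `red₀ (τ • Q) = red₀ Q`: there is a
`ℚ_v`-RATIONAL point `P₀` (fixed by all of `Γ_{ℚ_v}`) with `red₀ P₀ = red₀ Q`.  The coordinates `x̄, ȳ ∈ k̄_w` of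
`red₀ Q` satisfy `x̄^q = x̄` (`residueMap_pow_eq_of_reducePoint_smul_eq`), so they come from `𝔽_v` (the `q` roots of
`X^q − X`); the `𝔽_v`-point of the reduction `W_ℤ ⊗ 𝔽_v` (non-singular: good reduction) lifts to `W_ℤ(ℤ_v)` by Hensel's
lemma (`WeierstrassCurve.exists_equation_residue_eq`, `ℤ_v` henselian), and the lift reduces in `k̄_w` to `red₀ Q`
(`exists_residueMap`'s compatibility with `ℤ_v → 𝔽_v → k̄_w`). [cite: SilvermanAEC2009, VII.2 Prop. 2.1 (PDF p. 167)]
[cite: GreenbergLNM1716, §2 p. 70] -/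
theorem exists_fixed_localRed_eq (hpv : (p : 𝓞 ℚ) ∈ v.asIdeal) (hΔ : ¬ (p : ℤ) ∣ minimalDiscriminantInt W)
    {𝔐 : Ideal v.localAbsIntegers} (h𝔐 : 𝔐 ∈ v.localPrimesAbove)
    {τ : absoluteGaloisGroup (v.adicCompletion ℚ)} (hτ : IsArithFrobAt (v.adicCompletionIntegers ℚ) τ 𝔐)
    (Q : localPoints W (v.adicCompletion ℚ)) (hQ : red₀ (τ • Q) = red₀ Q) :
    ∃ P₀ : localPoints W (v.adicCompletion ℚ),
      (∀ σ : absoluteGaloisGroup (v.adicCompletion ℚ), σ • P₀ = P₀) ∧ red₀ P₀ = red₀ Q := by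
  have hvO : w.Integers w.valuationSubring := Valuation.valuationSubring.integers w
  haveI hV : (W.baseChange (AlgebraicClosure (v.adicCompletion ℚ))).IsIntegral w.integer :=
    ⟨⟨(integralModelInt W).map (algebraMap ℤ ↥w.integer), W.baseChange_eq_localIntModel_integer_baseChange⟩⟩
  obtain ⟨r, hr, hrc, hrF⟩ := exists_residueMap (v := v) hw h𝔐
  haveI : Finite (IsLocalRing.ResidueField (v.adicCompletionIntegers ℚ)) :=
    finite_residueField_adicCompletionIntegers ℚ v
  -- `r` factors through the residue field of `𝒪_w`, injectively
  have hker : ∀ a ∈ IsLocalRing.maximalIdeal ↥w.valuationSubring, r a = 0 := by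
    intro a ha
    rw [IsLocalRing.mem_maximalIdeal, mem_nonunits_iff, hvO.isUnit_iff_valuation_eq_one] at ha
    exact (hr a).mpr (lt_of_le_of_ne ((Valuation.mem_valuationSubring_iff w _).mp a.2) ha)
  let rt : IsLocalRing.ResidueField ↥w.valuationSubring →+*
      AlgebraicClosure (IsLocalRing.ResidueField (v.adicCompletionIntegers ℚ)) :=
    Ideal.Quotient.lift (IsLocalRing.maximalIdeal ↥w.valuationSubring) r hker
  have hrt : ∀ a, rt (IsLocalRing.residue ↥w.valuationSubring a) = r a := fun a ↦ Ideal.Quotient.lift_mk _ _ _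
  have hrt_inj : Function.Injective rt := RingHom.injective _
  rcases Q with _ | ⟨x, y, h⟩
  · exact ⟨0, fun σ ↦ smul_zero σ, rfl⟩
  by_cases hx : w x ≤ 1
  swap
  · -- non-integral abscissa: `Q` reduces to `0`
    refine ⟨0, fun σ ↦ smul_zero σ, ?_⟩
    rw [map_zero]
    exact ((W.localRed_eq_zero_iff_mem_kernel hΔu red₀ hred₀ _).mpr (some_mem_kernel h (not_le.mp hx))).symm
  -- the coordinates of the reduction satisfy `c^q = c`
  have heq := hQ
  rw [hred₀, hred₀] at heq
  obtain ⟨hy, hxq, hyq⟩ := residueMap_pow_eq_of_reducePoint_smul_eq hw hr hrF hτ hΔu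
    (localIntModel_baseChange W w.valuationSubring) hx rfl heq
  -- such elements of `k̄` come from `𝔽_v`
  have hroots : ∀ c : AlgebraicClosure (IsLocalRing.ResidueField (v.adicCompletionIntegers ℚ)),
      c ^ Nat.card (IsLocalRing.ResidueField (v.adicCompletionIntegers ℚ)) = c →
        ∃ c₀ : IsLocalRing.ResidueField (v.adicCompletionIntegers ℚ), algebraMap (IsLocalRing.ResidueField (v.adicCompletionIntegers ℚ)) (AlgebraicClosure (IsLocalRing.ResidueField (v.adicCompletionIntegers ℚ))) c₀ = c := by
    intro c hc
    set q := Nat.card (IsLocalRing.ResidueField (v.adicCompletionIntegers ℚ)) with hq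
    haveI : Fintype (IsLocalRing.ResidueField (v.adicCompletionIntegers ℚ)) := Fintype.ofFinite _
    have hq1 : 1 < q := by rw [hq]; exact Finite.one_lt_card
    let f : Polynomial (AlgebraicClosure (IsLocalRing.ResidueField (v.adicCompletionIntegers ℚ))) := X ^ q - X
    have hf0 : f ≠ 0 := FiniteField.X_pow_card_sub_X_ne_zero _ hq1
    have hdeg : f.natDegree = q := FiniteField.X_pow_card_sub_X_natDegree_eq _ hq1
    -- the image of `𝔽_v` consists of roots of `f` and has `q` elements
    let S : Finset (AlgebraicClosure (IsLocalRing.ResidueField (v.adicCompletionIntegers ℚ))) :=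
      Finset.univ.image (algebraMap (IsLocalRing.ResidueField (v.adicCompletionIntegers ℚ)) _)
    have hScard : S.card = q := by
      simp only [S]
      rw [Finset.card_image_of_injective _ (algebraMap (IsLocalRing.ResidueField (v.adicCompletionIntegers ℚ)) (AlgebraicClosure (IsLocalRing.ResidueField (v.adicCompletionIntegers ℚ)))).injective, Finset.card_univ, hq,
        Nat.card_eq_fintype_card]
    have hSroots : S ⊆ f.roots.toFinset := by
      intro a ha
      obtain ⟨a₀, -, rfl⟩ := Finset.mem_image.mp ha
      rw [Multiset.mem_toFinset, Polynomial.mem_roots hf0, Polynomial.IsRoot, eval_sub, eval_pow, eval_X,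
        ← map_pow, hq, ← Fintype.card_eq_nat_card, FiniteField.pow_card, sub_self]
    have hcroot : c ∈ f.roots.toFinset := by
      rw [Multiset.mem_toFinset, Polynomial.mem_roots hf0, Polynomial.IsRoot, eval_sub, eval_pow, eval_X, hc, sub_self]
    have hle : f.roots.toFinset.card ≤ q :=
      (Multiset.toFinset_card_le _).trans ((Polynomial.card_roots' f).trans hdeg.le)
    have hSeq : S = f.roots.toFinset := Finset.eq_of_subset_of_card_le hSroots (by rw [hScard]; exact hle)
    rw [← hSeq] at hcroot
    obtain ⟨c₀, -, hc₀⟩ := Finset.mem_image.mp hcroot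
    exact ⟨c₀, hc₀⟩
  obtain ⟨c₀, hc₀⟩ := hroots _ hxq
  obtain ⟨d₀, hd₀⟩ := hroots _ hyq
  -- the equation over `k̄`, then over `𝔽_v`
  have hMns : (((integralModelInt W).map (algebraMap ℤ ↥w.valuationSubring)).baseChange
      (AlgebraicClosure (v.adicCompletion ℚ))).toAffine.Nonsingular x y := by
    rw [localIntModel_baseChange W w.valuationSubring]; exact h
  have heqO : ((integralModelInt W).map (algebraMap ℤ ↥w.valuationSubring)).toAffine.Equation ⟨x, hx⟩ ⟨y, hy⟩ :=
    (map_equation_iff hvO.hom_inj).mp hMns.1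
  have hZk : (r.comp (algebraMap ℤ ↥w.valuationSubring)) =
      ((algebraMap (IsLocalRing.ResidueField (v.adicCompletionIntegers ℚ)) (AlgebraicClosure (IsLocalRing.ResidueField (v.adicCompletionIntegers ℚ)))).comp (IsLocalRing.residue (v.adicCompletionIntegers ℚ))).comp
        (algebraMap ℤ (v.adicCompletionIntegers ℚ)) :=
    RingHom.ext_int _ _
  have heqkbar : ((((integralModelInt W).map (algebraMap ℤ (v.adicCompletionIntegers ℚ))).map
      (IsLocalRing.residue (v.adicCompletionIntegers ℚ))).map
      (algebraMap (IsLocalRing.ResidueField (v.adicCompletionIntegers ℚ)) (AlgebraicClosure (IsLocalRing.ResidueField (v.adicCompletionIntegers ℚ))))).toAffine.Equation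
      (algebraMap (IsLocalRing.ResidueField (v.adicCompletionIntegers ℚ)) (AlgebraicClosure (IsLocalRing.ResidueField (v.adicCompletionIntegers ℚ))) c₀) (algebraMap (IsLocalRing.ResidueField (v.adicCompletionIntegers ℚ)) (AlgebraicClosure (IsLocalRing.ResidueField (v.adicCompletionIntegers ℚ))) d₀) := by
    rw [hc₀, hd₀, WeierstrassCurve.map_map, WeierstrassCurve.map_map, ← hZk, ← WeierstrassCurve.map_map]
    exact heqO.map r
  have heqk : (((integralModelInt W).map (algebraMap ℤ (v.adicCompletionIntegers ℚ))).map
      (IsLocalRing.residue (v.adicCompletionIntegers ℚ))).toAffine.Equation c₀ d₀ :=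
    (Affine.map_equation _ (algebraMap (IsLocalRing.ResidueField (v.adicCompletionIntegers ℚ)) (AlgebraicClosure (IsLocalRing.ResidueField (v.adicCompletionIntegers ℚ)))).injective c₀ d₀).mp heqkbar
  -- the reduction `W_ℤ ⊗ 𝔽_v` is non-singular (`p ∤ Δ`), so the point is non-singular and lifts (Hensel)
  have hϖ : Irreducible ((p : ℕ) : v.adicCompletionIntegers ℚ) := irreducible_natCast_adicCompletionIntegers_rat hpv
  haveI hchark : CharP (IsLocalRing.ResidueField (v.adicCompletionIntegers ℚ)) p := by
    refine (CharP.charP_iff_prime_eq_zero hp.out).mpr ?_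
    rw [← map_natCast (IsLocalRing.residue (v.adicCompletionIntegers ℚ)), IsLocalRing.residue_eq_zero_iff]
    exact hϖ.not_isUnit
  haveI : ((((integralModelInt W).map (algebraMap ℤ (v.adicCompletionIntegers ℚ))).map
      (IsLocalRing.residue (v.adicCompletionIntegers ℚ)))).IsElliptic := by
    refine ⟨?_⟩
    rw [map_Δ, map_Δ, eq_intCast, map_intCast, isUnit_iff_ne_zero, ne_eq, CharP.intCast_eq_zero_iff _ p]
    exact hΔ
  have hns₀ : (((integralModelInt W).map (algebraMap ℤ (v.adicCompletionIntegers ℚ))).map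
      (IsLocalRing.residue (v.adicCompletionIntegers ℚ))).toAffine.Nonsingular c₀ d₀ :=
    (Affine.equation_iff_nonsingular).mp heqk
  haveI : HenselianLocalRing (v.adicCompletionIntegers ℚ) := inferInstance
  obtain ⟨a, b, hab, hac, hbd⟩ :=
    ((integralModelInt W).map (algebraMap ℤ (v.adicCompletionIntegers ℚ))).exists_equation_residue_eq hns₀
  -- the rational point
  let ι : v.adicCompletionIntegers ℚ →+* AlgebraicClosure (v.adicCompletion ℚ) :=
    (algebraMap (v.adicCompletion ℚ) (AlgebraicClosure (v.adicCompletion ℚ))).comp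
      (algebraMap (v.adicCompletionIntegers ℚ) (v.adicCompletion ℚ))
  have hιZ : ι.comp (algebraMap ℤ (v.adicCompletionIntegers ℚ)) =
      (algebraMap ↥w.valuationSubring (AlgebraicClosure (v.adicCompletion ℚ))).comp
        (algebraMap ℤ ↥w.valuationSubring) := RingHom.ext_int _ _
  have habK : (W.baseChange (AlgebraicClosure (v.adicCompletion ℚ))).toAffine.Equation
      (algebraMap (v.adicCompletion ℚ) (AlgebraicClosure (v.adicCompletion ℚ)) (algebraMap (v.adicCompletionIntegers ℚ) (v.adicCompletion ℚ) a))
      (algebraMap (v.adicCompletion ℚ) (AlgebraicClosure (v.adicCompletion ℚ)) (algebraMap (v.adicCompletionIntegers ℚ) (v.adicCompletion ℚ) b)) := by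
    rw [← localIntModel_baseChange W w.valuationSubring, baseChange, WeierstrassCurve.map_map, ← hιZ,
      ← WeierstrassCurve.map_map]
    exact hab.map ι
  have hnsK : (W.baseChange (AlgebraicClosure (v.adicCompletion ℚ))).toAffine.Nonsingular
      (algebraMap (v.adicCompletion ℚ) (AlgebraicClosure (v.adicCompletion ℚ)) (algebraMap (v.adicCompletionIntegers ℚ) (v.adicCompletion ℚ) a))
      (algebraMap (v.adicCompletion ℚ) (AlgebraicClosure (v.adicCompletion ℚ)) (algebraMap (v.adicCompletionIntegers ℚ) (v.adicCompletion ℚ) b)) :=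
    (Affine.equation_iff_nonsingular).mp habK
  refine ⟨Affine.Point.some _ _ hnsK, fun σ ↦ ?_, ?_⟩
  · -- fixed by `Γ_{ℚ_v}`: the coordinates lie in `ℚ_v`
    rw [localPoints.smul_def, Affine.Point.map_some]
    congr 1
    · exact σ.commutes (algebraMap (v.adicCompletionIntegers ℚ) (v.adicCompletion ℚ) a)
    · exact σ.commutes (algebraMap (v.adicCompletionIntegers ℚ) (v.adicCompletion ℚ) b)
  · -- same reduction: compare the residues in `k̄` through the injective `rt`
    have hint1 : ∀ c : v.adicCompletionIntegers ℚ, w (algebraMap (v.adicCompletion ℚ) (AlgebraicClosure (v.adicCompletion ℚ)) (algebraMap (v.adicCompletionIntegers ℚ) (v.adicCompletion ℚ) c)) ≤ 1 := fun c ↦ by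
      have h1 : (w (algebraMap (v.adicCompletion ℚ) (AlgebraicClosure (v.adicCompletion ℚ)) (algebraMap (v.adicCompletionIntegers ℚ) (v.adicCompletion ℚ) c)) : ℝ) = ‖algebraMap (v.adicCompletionIntegers ℚ) (v.adicCompletion ℚ) c‖ := by
        rw [hw]; exact spectralNorm_extends _
      have h2 : ‖algebraMap (v.adicCompletionIntegers ℚ) (v.adicCompletion ℚ) c‖ ≤ 1 :=
        (Valued.toNormedField.norm_le_one_iff).mpr c.2
      rw [← NNReal.coe_le_coe, h1, NNReal.coe_one]; exact h2
    obtain ⟨hb1, hns1, e1⟩ := reducePoint_congrEquiv_some_of_val_le_one hΔu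
      (localIntModel_baseChange W w.valuationSubring) _ _ hnsK (hint1 a)
    obtain ⟨hy', hns2, e2⟩ := reducePoint_congrEquiv_some_of_val_le_one hΔu
      (localIntModel_baseChange W w.valuationSubring) x y h hx
    rw [hred₀, hred₀, e1, e2, Affine.Point.some.injEq]
    refine ⟨hrt_inj ?_, hrt_inj ?_⟩
    · rw [hrt, hrt]
      exact (hrc a (hint1 a)).trans (by rw [hac]; exact hc₀)
    · rw [hrt, hrt]
      exact (hrc b (hint1 b)).trans (by rw [hbd]; exact hd₀)

/-! ## §D `#Ẽ(k̄_w)[p] ≤ p` at a good ordinary prime -/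

include hΔu hred₀ in
/-- **`Ẽ(k̄_w)[p]` is finite of order `≤ p` at a good ORDINARY `v ∣ p`**: by the ordinary filtration
(`localRed_ordinary_filtration`: `red₀` maps `E[p]` onto `Ẽ[p]` and `ker red₀ ∩ E[p]` is cyclic of order `p`) and
`#E(K̄_v)[p] = p²` (`card_torsionPoints_eq_sq`), the `p`-torsion of the target of `red₀` has at most `p² / p = p`
elements. [cite: GreenbergLNM1716, §1 p. 62] [cite: SilvermanAEC2009, Cor. III.6.4(b)] -/
theorem finite_torsionBy_localRed_target_and_card_le [CharP (IsLocalRing.ResidueField ↥w.valuationSubring) p]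
    (hordA : ∃ P : localPoints W (v.adicCompletion ℚ), (p : ℤ) • P = 0 ∧ red₀ P ≠ 0) :
    Finite {t : (((integralModelInt W).map (algebraMap ℤ ↥w.valuationSubring)).map
        (IsLocalRing.residue ↥w.valuationSubring)).toAffine.Point // p • t = 0} ∧
      Nat.card {t : (((integralModelInt W).map (algebraMap ℤ ↥w.valuationSubring)).map
        (IsLocalRing.residue ↥w.valuationSubring)).toAffine.Point // p • t = 0} ≤ p := by
  obtain ⟨hgenr, hsurj, -⟩ := W.localRed_ordinary_filtration hΔu red₀ hred₀ hordA
  obtain ⟨P₁, hP₁0, hP₁ord, hP₁gen⟩ := hgenr 1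
  rw [pow_one] at hP₁ord
  -- `E[p]` has `p²` elements
  have hp0 : (p : AlgebraicClosure (v.adicCompletion ℚ)) ≠ 0 := by
    rw [← map_natCast (algebraMap ℚ (AlgebraicClosure (v.adicCompletion ℚ)))]
    exact (_root_.map_ne_zero _).mpr (Nat.cast_ne_zero.mpr hp.out.ne_zero)
  have hcardE : Nat.card (AddSubgroup.torsionBy (localPoints W (v.adicCompletion ℚ)) (p : ℤ)) = p ^ 2 :=
    WeierstrassCurve.card_torsionPoints_eq_sq_holds W (AlgebraicClosure (v.adicCompletion ℚ)) (n := p) hp0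
  haveI hfinE : Finite (AddSubgroup.torsionBy (localPoints W (v.adicCompletion ℚ)) (p : ℤ)) :=
    Nat.finite_of_card_ne_zero (by rw [hcardE]; exact pow_ne_zero 2 hp.out.ne_zero)
  -- `red₀` restricted to `E[p]`, onto the `p`-torsion of the target
  let Tp := {t : (((integralModelInt W).map (algebraMap ℤ ↥w.valuationSubring)).map
        (IsLocalRing.residue ↥w.valuationSubring)).toAffine.Point // p • t = 0}
  let ρ : AddSubgroup.torsionBy (localPoints W (v.adicCompletion ℚ)) (p : ℤ) → Tp := fun x ↦
    ⟨red₀ x.1, by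
      have hx := (Submodule.mem_torsionBy_iff _ _).mp x.2
      rw [← map_nsmul, ← natCast_zsmul, hx, map_zero]⟩
  have hρsurj : Function.Surjective ρ := by
    rintro ⟨t, ht⟩
    have ht' : ((p ^ 1 : ℕ) : ℤ) • t = 0 := by rw [pow_one, natCast_zsmul]; exact ht
    obtain ⟨x, hx, hxt⟩ := hsurj 1 t ht'
    rw [pow_one] at hx
    exact ⟨⟨x, (Submodule.mem_torsionBy_iff _ _).mpr hx⟩, Subtype.ext hxt⟩
  haveI : Finite Tp := Finite.of_surjective ρ hρsurj
  refine ⟨inferInstance, ?_⟩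
  -- the fibre over `0` contains the `p` multiples of `P₁`
  have hP₁tor : (p : ℤ) • P₁ = 0 := by
    rw [natCast_zsmul, ← hP₁ord]; exact addOrderOf_nsmul_eq_zero P₁
  let mult : Fin p → AddSubgroup.torsionBy (localPoints W (v.adicCompletion ℚ)) (p : ℤ) := fun i ↦
    ⟨(i : ℕ) • P₁, (Submodule.mem_torsionBy_iff _ _).mpr (by rw [smul_comm, hP₁tor, smul_zero])⟩
  have hmult_inj : Function.Injective mult := by
    intro i j h
    have h' : (i : ℕ) • P₁ = (j : ℕ) • P₁ := congrArg Subtype.val h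
    have := (nsmul_injOn_Iio_addOrderOf (x := P₁)) (by rw [hP₁ord]; exact i.2) (by rw [hP₁ord]; exact j.2) h'
    exact Fin.ext this
  -- count: every fibre of `ρ` has at least `p` elements (translate the fibre over `0`)
  have hfib : ∀ t : Tp, p ≤ Nat.card {x // ρ x = t} := fun t ↦ by
    obtain ⟨x₀, hx₀⟩ := hρsurj t
    let ins : Fin p → {x // ρ x = t} := fun i ↦ ⟨x₀ + mult i, by
      apply Subtype.ext
      change red₀ (x₀.1 + (i : ℕ) • P₁) = t.1
      rw [map_add, map_nsmul, hP₁0, nsmul_zero, add_zero]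
      exact congrArg Subtype.val hx₀⟩
    have hins : Function.Injective ins := fun i j h ↦ hmult_inj (add_left_cancel (congrArg Subtype.val h))
    haveI : Finite {x // ρ x = t} := Subtype.finite
    simpa using Nat.card_le_card_of_injective ins hins
  -- `p · #Tp ≤ Σ_t #fibre = #E[p] = p²`
  haveI : Fintype Tp := Fintype.ofFinite Tp
  have hsum : Nat.card (AddSubgroup.torsionBy (localPoints W (v.adicCompletion ℚ)) (p : ℤ)) =
      ∑ t : Tp, Nat.card {x // ρ x = t} := by
    rw [← Nat.card_sigma]
    exact Nat.card_congr (Equiv.sigmaFiberEquiv ρ).symm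
  have hle : p * Nat.card Tp ≤ p ^ 2 := by
    rw [← hcardE, hsum, Nat.card_eq_fintype_card, mul_comm]
    calc Fintype.card Tp * p = ∑ _t : Tp, p := by rw [Finset.sum_const, Finset.card_univ, smul_eq_mul]
      _ ≤ ∑ t : Tp, Nat.card {x // ρ x = t} := Finset.sum_le_sum fun t _ ↦ hfib t
  rw [pow_two] at hle
  exact Nat.le_of_mul_le_mul_left hle hp.out.pos

end Literature.NumberTheory.EllipticCurves.Greenberg1999.GoodOrdTower

end Part3

/-!
## Part 4 — port of `Summits/BirchSwinnertonDyer/BirchSwinnertonDyer/Theorems/ByReductionTypeAtTwoGoodOrdTowerCoinvCocycle.lean`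

# Route `ByReductionTypeAtTwo`, item `OrdKatoHalfAtTwo` (stmt-BirchSwinnertonDyer-19271), TOWER road, the
# GOOD-ORDINARY local constant at `v ∣ 2`: KERNEL BRICK G2 — the inflated cocycle of a coinvariant class on the local
# layer group `H_n`, at ANY prime `p`

HONEST FRAMING (cell `bsd-2adic`, run/shared/lean/pub/bsd-2adic/, seat `bsd-2adic-tower-1` GEN 11, HUMAN RULINGS
D-0036 / D-0054 / D-0074): TOOL theorems only (no definition, no named fact, no `sorry`); closes nothing by itself;
nothing booked; BSD is not proved by any of this. Second brick of the KERNELISATION of the consumed projection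
`#𝒦_{v,n}[2^∞][2] ≤ 4` of the PRINT binder `hS34 = Greenberg1999.lemma34_localTowerKerPrimary_cyclicExtension_rat`
(Greenberg, LNM 1716, §3 Lemma 3.4 / Prop. 2.5), scope memo HOME/tower/SCOPE-hS34-layer-kernel-at-2-GEN7.md §1 steps 2–3
(«Kummer on `E₁`»). Setting: `p` any prime, `κ` the cyclotomic `ℤ_p`-extension of `ℚ`, `v ∋ p`, `K = ℚ_v`, `Γ = Gal(K̄/K)`,
`H_m = localSubgroup (κ.layerSubgroup m) K`, `H_∞ = localSubgroup κ.kerSubgroup K`, `E(K̄_v) = localPoints W K` for a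
Weierstrass curve `W/ℚ`, `g ∈ H_n` a topological generator of `H_n` modulo `H_∞`.

* `exists_pow_inv_mul_mem_localSubgroup_layerSubgroup` — the cosets of `H_{n+R}` in `H_n` are `g^i H_{n+R}`, `i < p^R`
  (the `p`-general form of GEN 9's `MultTowerNS2.exists_pow_inv_mul_mem_localSubgroup_layerSubgroup`);
* `exists_forall_mem_localSubgroup_layerSubgroup_smul_point_eq` — **finite level for points**: a point of `E(K̄_v)` fixed
  by `H_∞` is fixed by some `H_m` (coordinates + GEN 10's `MultTowerSP1.exists_forall_mem_localSubgroup_layerSubgroup_smul_eq`);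
* `geomSum_nsmul`, `geomSum_smul_sub_eq`, `geomSum_mul_eq_nsmul_of_apply_eq` — bookkeeping for the geometric sums
  `S_i(x) = Σ_{j<i} g^j x` of the tree's `FrobeniusQuotientHOne` (`p S_i(x) = S_i(p x)`, `S_i(g y − y) = g^i y − y`,
  `S_{a k}(x) = k S_a(x)` when `g^a` fixes `S_a(x)`);
* **`exists_contOneCocycles_inflate`** — for a `Γ`-stable subgroup `A₁ ≤ E(K̄_v)` whose `p`-torsion is fixed by `Γ`
  («`Ê[p] ⊂ Ê(𝔪_{ℚ_p})`», automatic at `p = 2`) and `x ∈ A₁`, `y` fixed by `H_∞` with `p x = g y − y` (a `p`-TORSION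
  COINVARIANT CLASS `[x]` of `A₁^{H_∞}/(g − 1)`), there is a continuous `1`-cocycle `c` of `H_n` with values in `A₁`,
  vanishing on `H_∞`, with `c(g) = x` and `p c(σ) = σ y − y` for all `σ ∈ H_n`: the cocycle `σ = g^i h ↦ S_i(x)` of the
  finite cyclic level `H_n/H_{n+R}` (the norm `S_{p^R}(x)` vanishes one level above the level fixing `x, y`, because
  `p S_{p^{R−1}}(x) = g^{p^{R−1}} y − y = 0` puts `S_{p^{R−1}}(x)` in the `Γ`-fixed `A₁[p]`).
  Part 2 (`…GoodOrdTowerCoinvKummer.lean`) turns `c − ∂ỹ` (`p ỹ = y`) into a `Γ`-fixed-`A₁[p]`-valued character of `H_n` and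
  counts: `#(A₁^{H_∞}/(g−1))[p] · #(A₁^{H_n}/p) ≤ #Hom_cont(H_n, A₁[p])`.

References: R. Greenberg, LNM 1716 (1999), §3 Lemma 3.1 (p. 86: `H¹(Γ_n, B) = B/(γ − 1)B`), Lemma 3.4 (p. 89); J.-P. Serre,
*Local Fields*, XIII §1 Prop. 1; L. Washington, *Introduction to Cyclotomic Fields*, §13.1; scope memo §1.
-/

section Part4

set_option autoImplicit false

open scoped _root_.Classical

universe u

namespace Literature.NumberTheory.EllipticCurves.Greenberg1999.GoodOrdTower

open _root_.NumberField _root_.IsDedekindDomain _root_.Field _root_.PadicInt Literature.NumberTheory.EllipticCurves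
  Literature.NumberTheory.GaloisRepresentations _root_.WeierstrassCurve

variable {p : ℕ} [Fact p.Prime] {κ : ZpExtension ℚ p}

/-! ### Cosets of `H_{n+R}` in `H_n` -/

/-- **The cosets of `H_{n+R}` in `H_n` are `g^i H_{n+R}`, `i < p^R`**: for `g` with `κ(res g) = p^n u` (`u` a unit) and
`h ∈ H_n` there is `i < p^R` with `(g^i)⁻¹ h ∈ H_{n+R}` (`κ(res h) = p^n c`, `i ≡ c u⁻¹ (mod p^R)`). The `p`-general form of
`MultTowerNS2.exists_pow_inv_mul_mem_localSubgroup_layerSubgroup`. [cite: Washington1997, §13.1] -/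
theorem exists_pow_inv_mul_mem_localSubgroup_layerSubgroup (v : HeightOneSpectrum (𝓞 ℚ)) (n R : ℕ)
    {g : absoluteGaloisGroup (v.adicCompletion ℚ)} {u : ℤ_[p]ˣ}
    (hu : ((κ (resGal (K := ℚ) (v.adicCompletion ℚ) g)).toAdd : ℤ_[p]) = (p : ℤ_[p]) ^ n * (u : ℤ_[p]))
    {h : absoluteGaloisGroup (v.adicCompletion ℚ)} (hh : h ∈ localSubgroup (κ.layerSubgroup n) (v.adicCompletion ℚ)) :
    ∃ i : ℕ, i < p ^ R ∧ (g ^ i)⁻¹ * h ∈ localSubgroup (κ.layerSubgroup (n + R)) (v.adicCompletion ℚ) := by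
  rw [mem_localSubgroup_iff, ZpExtension.mem_layerSubgroup] at hh
  obtain ⟨c, hc⟩ := hh
  set i : ℕ := (toZModPow R (c * ((u⁻¹ : ℤ_[p]ˣ) : ℤ_[p]))).val with hi
  refine ⟨i, ZMod.val_lt _, ?_⟩
  rw [mem_localSubgroup_iff, ZpExtension.mem_layerSubgroup]
  simp only [map_mul, map_inv, map_pow, toAdd_mul, toAdd_inv, toAdd_pow, hu]
  have hc' : ((κ (resGal (K := ℚ) (v.adicCompletion ℚ) h)).toAdd : ℤ_[p]) = (p : ℤ_[p]) ^ n * c := by exact_mod_cast hc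
  rw [hc']
  -- `c u⁻¹ - i ∈ p^R ℤ_p`
  have hker : c * ((u⁻¹ : ℤ_[p]ˣ) : ℤ_[p]) - (i : ℤ_[p]) ∈ RingHom.ker (toZModPow (p := p) R) := by
    rw [RingHom.mem_ker, map_sub, map_natCast, hi, ZMod.natCast_zmod_val, sub_self]
  rw [ker_toZModPow, Ideal.mem_span_singleton] at hker
  obtain ⟨d, hd⟩ := hker
  refine ⟨(u : ℤ_[p]) * d, ?_⟩
  have hud : c - (i : ℤ_[p]) * (u : ℤ_[p]) = (u : ℤ_[p]) * ((p : ℤ_[p]) ^ R * d) := by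
    have h1 : (u : ℤ_[p]) * (c * ((u⁻¹ : ℤ_[p]ˣ) : ℤ_[p]) - (i : ℤ_[p])) = c - (i : ℤ_[p]) * (u : ℤ_[p]) := by
      rw [mul_sub, ← mul_assoc, mul_comm (u : ℤ_[p]) c, mul_assoc, Units.mul_inv, mul_one, mul_comm]
    rw [← h1, hd]
  rw [nsmul_eq_mul]
  linear_combination (p : ℤ_[p]) ^ n * hud

/-! ### Finite level for points -/

/-- Two affine points with equal coordinates are equal (the nonsingularity proofs are irrelevant). [folklore] -/
private theorem point_some_eq_some {F : Type u} [Field F] {V : WeierstrassCurve F} {x x' y y' : F}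
    (hx : x = x') (hy : y = y') {h : V.toAffine.Nonsingular x y} {h' : V.toAffine.Nonsingular x' y'} :
    Affine.Point.some x y h = Affine.Point.some x' y' h' := by
  subst hx; subst hy; rfl

/-- **Finite level for points**: a point of `E(K̄_v)` fixed by every element of `H_∞` is fixed by every element of some
`H_m` (apply the field-element statement `MultTowerSP1.exists_forall_mem_localSubgroup_layerSubgroup_smul_eq` to the two
coordinates and take the larger level). [cite: NeukirchANT1999, Ch. IV §1] -/
theorem exists_forall_mem_localSubgroup_layerSubgroup_smul_point_eq (v : HeightOneSpectrum (𝓞 ℚ))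
    (W : WeierstrassCurve ℚ) (P : localPoints W (v.adicCompletion ℚ))
    (hP : ∀ h ∈ localSubgroup κ.kerSubgroup (v.adicCompletion ℚ), h • P = P) :
    ∃ m : ℕ, ∀ h ∈ localSubgroup (κ.layerSubgroup m) (v.adicCompletion ℚ), h • P = P := by
  change (W.baseChange (AlgebraicClosure (v.adicCompletion ℚ))).toAffine.Point at P
  rcases P with _ | ⟨x, y, hxy⟩
  · exact ⟨0, fun h _ ↦ smul_zero h⟩
  · -- `h • (x, y) = (h x, h y)`
    have hsm : ∀ h : absoluteGaloisGroup (v.adicCompletion ℚ), ∃ h₂,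
        h • (show localPoints W (v.adicCompletion ℚ) from Affine.Point.some x y hxy) =
          Affine.Point.some (h • x) (h • y) h₂ := fun h ↦
      ⟨_, by rw [localPoints.smul_def, Affine.Point.map_some]; rfl⟩
    -- the coordinates are fixed by `H_∞`
    have hcoord : ∀ h ∈ localSubgroup κ.kerSubgroup (v.adicCompletion ℚ), h • x = x ∧ h • y = y := by
      intro h hh
      obtain ⟨h₂, e⟩ := hsm h
      have e' := hP h hh
      rw [e] at e'
      injection e' with ex ey
      exact ⟨ex, ey⟩
    obtain ⟨m₁, hm₁⟩ := MultTowerSP1.exists_forall_mem_localSubgroup_layerSubgroup_smul_eq (κ := κ) v x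
      fun h hh ↦ (hcoord h hh).1
    obtain ⟨m₂, hm₂⟩ := MultTowerSP1.exists_forall_mem_localSubgroup_layerSubgroup_smul_eq (κ := κ) v y
      fun h hh ↦ (hcoord h hh).2
    refine ⟨max m₁ m₂, fun h hh ↦ ?_⟩
    have h₁ : h • x = x :=
      hm₁ h (MultTowerSP1.localSubgroup_layerSubgroup_antitone κ (v.adicCompletion ℚ) (le_max_left m₁ m₂) hh)
    have h₂ : h • y = y :=
      hm₂ h (MultTowerSP1.localSubgroup_layerSubgroup_antitone κ (v.adicCompletion ℚ) (le_max_right m₁ m₂) hh)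
    obtain ⟨h₃, e⟩ := hsm h
    rw [e]
    exact point_some_eq_some h₁ h₂

/-! ### Geometric sums in a discrete module -/

section GeomSum

variable {G : Type u} [Group G] {X : TopRep.{u} ℤ G} (F : G)

/-- `S_i(n • b) = n • S_i(b)`. [folklore] -/
private theorem geomSum_nsmul (b₀ : X) (n i : ℕ) : geomSum F (n • b₀) i = n • geomSum F b₀ i := by
  simp only [geomSum, map_nsmul, Finset.smul_sum]

/-- Telescoping: `S_i(F y − y) = F^i y − y`. [folklore] -/
private theorem geomSum_smul_sub_eq (y : X) (i : ℕ) : geomSum F (X.ρ F y - y) i = X.ρ (F ^ i) y - y := by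
  induction i with
  | zero => rw [geomSum_zero, pow_zero, map_one]; exact (sub_self _).symm
  | succ i ih =>
    rw [geomSum_succ, ih, map_sub, ← mul_apply_eq_comp, ← map_mul, ← pow_succ]
    abel

/-- `S_{a k}(b) = k • S_a(b)` as soon as `F^a` fixes `S_a(b)` (the tree's `geomSum_mul_eq_smul` asks `F^a` to act
trivially on the whole module). [folklore] -/
private theorem geomSum_mul_eq_nsmul_of_apply_eq (b₀ : X) {a : ℕ} (ha : X.ρ (F ^ a) (geomSum F b₀ a) = geomSum F b₀ a)
    (k : ℕ) : geomSum F b₀ (a * k) = k • geomSum F b₀ a := by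
  have hak : ∀ k : ℕ, X.ρ (F ^ (a * k)) (geomSum F b₀ a) = geomSum F b₀ a := fun k ↦ by
    induction k with
    | zero => rw [mul_zero, pow_zero, map_one]; rfl
    | succ k ih => rw [Nat.mul_succ, pow_add, map_mul, mul_apply_eq_comp, ha, ih]
  induction k with
  | zero => rw [mul_zero, geomSum_zero, zero_smul]
  | succ k ih => rw [Nat.mul_succ, geomSum_add, ih, hak, succ_nsmul]

end GeomSum

/-! ### The inflated cocycle of a `p`-torsion coinvariant class -/

/-- **The inflated cocycle of a `p`-torsion coinvariant class.** Let `A₁ ≤ E(K̄_v)` be a `Γ`-stable subgroup whose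
`p`-torsion elements are fixed by `Γ`, `g ∈ H_n` a topological generator of `H_n` modulo `H_∞` (the binder shape of BRICK
11 `MultTowerNS2.finite_torsionBy_localTowerKerPrimary_and_card_le`), and `x ∈ A₁`, `y ∈ E(K̄_v)` fixed by `H_∞` with
`p x = g y − y`.
Then there is a continuous `1`-cocycle `c` of `H_n` with values in `E(K̄_v)` such that `c` vanishes on `H_∞`, `c(g) = x`,
`c(σ) ∈ A₁` and `p c(σ) = σ y − y` for every `σ ∈ H_n`. Construction: `x, y` are fixed by some `H_{n+R₀}` (finite level);
with `R = R₀ + 1` the geometric sums `S_i(x) = Σ_{j<i} g^j x` satisfy `S_{p^R}(x) = p S_{p^{R₀}}(x) = 0` (as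
`p S_{p^{R₀}}(x) = S_{p^{R₀}}(g y − y) = g^{p^{R₀}} y − y = 0`, so `S_{p^{R₀}}(x) ∈ A₁[p]` is fixed by `g^{p^{R₀}}`), hence
`σ = g^i h ↦ S_i(x)` (`h ∈ H_{n+R}`) is a well-defined cocycle of the cyclic group `H_n/H_{n+R} = ⟨ḡ⟩` of order `p^R`,
inflated to `H_n` (the tree's `geomSum`/`idxQ` of `FrobeniusQuotientHOne` / `CyclicQuotientTwoCocycle`).
[cite: GreenbergLNM1716, §3 Lemma 3.1 (p. 86)] [cite: SerreLocalFields1979, XIII §1 Prop. 1] -/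
theorem exists_contOneCocycles_inflate (hκ : κ.IsCyclotomic) (v : HeightOneSpectrum (𝓞 ℚ))
    (hv : ((p : ℕ) : 𝓞 ℚ) ∈ v.asIdeal) (W : WeierstrassCurve ℚ) (n : ℕ)
    {g : absoluteGaloisGroup (v.adicCompletion ℚ)}
    (hg : g ∈ localSubgroup (κ.layerSubgroup n) (v.adicCompletion ℚ))
    (hgen : ∀ U : Subgroup (absoluteGaloisGroup (v.adicCompletion ℚ)),
      IsOpen (U : Set (absoluteGaloisGroup (v.adicCompletion ℚ))) →
        localSubgroup κ.kerSubgroup (v.adicCompletion ℚ) ≤ U → g ∈ U →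
          localSubgroup (κ.layerSubgroup n) (v.adicCompletion ℚ) ≤ U)
    (A₁ : AddSubgroup (localPoints W (v.adicCompletion ℚ)))
    (hstab : ∀ (σ : absoluteGaloisGroup (v.adicCompletion ℚ)) (a : localPoints W (v.adicCompletion ℚ)),
      a ∈ A₁ → σ • a ∈ A₁)
    (hZ : ∀ a ∈ A₁, p • a = 0 → ∀ σ : absoluteGaloisGroup (v.adicCompletion ℚ), σ • a = a)
    {x y : localPoints W (v.adicCompletion ℚ)} (hx : x ∈ A₁)
    (hxi : ∀ h ∈ localSubgroup κ.kerSubgroup (v.adicCompletion ℚ), h • x = x)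
    (hyi : ∀ h ∈ localSubgroup κ.kerSubgroup (v.adicCompletion ℚ), h • y = y)
    (hrel : p • x = g • y - y) :
    ∃ c : contOneCocycles (discreteTopRep (localSubgroup (κ.layerSubgroup n) (v.adicCompletion ℚ))
      (localPoints W (v.adicCompletion ℚ))),
      (∀ σ : localSubgroup (κ.layerSubgroup n) (v.adicCompletion ℚ),
        (σ : absoluteGaloisGroup (v.adicCompletion ℚ)) ∈ localSubgroup κ.kerSubgroup (v.adicCompletion ℚ) →
          c.1 σ = 0) ∧
      c.1 ⟨g, hg⟩ = x ∧
      (∀ σ : localSubgroup (κ.layerSubgroup n) (v.adicCompletion ℚ), c.1 σ ∈ A₁) ∧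
      (∀ σ : localSubgroup (κ.layerSubgroup n) (v.adicCompletion ℚ),
        p • c.1 σ = (σ : absoluteGaloisGroup (v.adicCompletion ℚ)) • y - y) := by
  -- notation (`let`, not `set`: no context rewriting)
  let K := v.adicCompletion ℚ
  let P : Type := localPoints W K
  let Hn : Subgroup (absoluteGaloisGroup K) := localSubgroup (κ.layerSubgroup n) K
  let X : TopRep ℤ Hn := discreteTopRep Hn P
  let γ : Hn := ⟨g, hg⟩
  have hXρ : ∀ (σ : Hn) (m : P), X.ρ σ m = (σ : absoluteGaloisGroup K) • m := fun _ _ ↦ rfl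
  have hXρpow : ∀ (j : ℕ) (m : P), X.ρ (γ ^ j) m = (g ^ j) • m := fun j m ↦ by
    rw [hXρ, SubgroupClass.coe_pow]
  -- `κ(res g) = p^n u`
  obtain ⟨u, hu⟩ := MultTowerSP1.exists_units_kappa_resGal_eq_of_generate hκ v hv n hg hgen
  have hgi : ∀ (R i : ℕ), g ^ i ∈ localSubgroup (κ.layerSubgroup (n + R)) K ↔ p ^ R ∣ i := fun R i ↦
    MultTowerSP1.pow_mem_localSubgroup_layerSubgroup_iff (κ := κ) v n R hu i
  -- a common finite level `n + R₀` for `x` and `y`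
  obtain ⟨m₁, hm₁⟩ := exists_forall_mem_localSubgroup_layerSubgroup_smul_point_eq (κ := κ) v W x hxi
  obtain ⟨m₂, hm₂⟩ := exists_forall_mem_localSubgroup_layerSubgroup_smul_point_eq (κ := κ) v W y hyi
  obtain ⟨R₀, hxR₀, hyR₀⟩ : ∃ R₀ : ℕ, (∀ h ∈ localSubgroup (κ.layerSubgroup (n + R₀)) K, h • x = x) ∧
      ∀ h ∈ localSubgroup (κ.layerSubgroup (n + R₀)) K, h • y = y :=
    ⟨max m₁ m₂,
      fun h hh ↦ hm₁ h (MultTowerSP1.localSubgroup_layerSubgroup_antitone κ K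
        ((le_max_left m₁ m₂).trans (Nat.le_add_left _ n)) hh),
      fun h hh ↦ hm₂ h (MultTowerSP1.localSubgroup_layerSubgroup_antitone κ K
        ((le_max_right m₁ m₂).trans (Nat.le_add_left _ n)) hh)⟩
  have hleR : localSubgroup (κ.layerSubgroup (n + (R₀ + 1))) K ≤ localSubgroup (κ.layerSubgroup (n + R₀)) K :=
    MultTowerSP1.localSubgroup_layerSubgroup_antitone κ K (by omega)
  have hxR : ∀ h ∈ localSubgroup (κ.layerSubgroup (n + (R₀ + 1))) K, h • x = x := fun h hh ↦ hxR₀ h (hleR hh)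
  have hyR : ∀ h ∈ localSubgroup (κ.layerSubgroup (n + (R₀ + 1))) K, h • y = y := fun h hh ↦ hyR₀ h (hleR hh)
  -- the open normal subgroup `H = H_{n+R₀+1} ∩ H_n` of `H_n` and the cyclic quotient `H_n / H = ⟨ḡ⟩`
  have hnormal : (localSubgroup (κ.layerSubgroup (n + (R₀ + 1))) K).Normal := by
    rw [localSubgroup_eq_comap]; exact Subgroup.Normal.comap inferInstance _
  let H : Subgroup Hn := (localSubgroup (κ.layerSubgroup (n + (R₀ + 1))) K).subgroupOf Hn
  haveI hHnormal : H.Normal := Subgroup.normal_subgroupOf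
  have hmemH : ∀ σ : Hn, σ ∈ H ↔
      (σ : absoluteGaloisGroup K) ∈ localSubgroup (κ.layerSubgroup (n + (R₀ + 1))) K :=
    fun σ ↦ Subgroup.mem_subgroupOf
  have hHopen : IsOpen (H : Set Hn) :=
    (MultTowerNS2.isOpen_localSubgroup _ (κ.isOpen_layerSubgroup (n + (R₀ + 1))) K).preimage
      continuous_subtype_val
  have hgenQ : ∀ q : Hn ⧸ H, ∃ i : ℕ, q = (QuotientGroup.mk γ : Hn ⧸ H) ^ i := by
    intro q
    obtain ⟨σ, rfl⟩ := QuotientGroup.mk_surjective q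
    obtain ⟨i, -, hi⟩ := exists_pow_inv_mul_mem_localSubgroup_layerSubgroup (κ := κ) v n (R₀ + 1) hu σ.2
    refine ⟨i, ?_⟩
    rw [← QuotientGroup.mk_pow, eq_comm, QuotientGroup.eq, hmemH]
    simpa only [Subgroup.coe_mul, Subgroup.coe_inv, SubgroupClass.coe_pow] using hi
  -- the order of `ḡ` is `p^(R₀+1)`
  have hord : orderOf (QuotientGroup.mk γ : Hn ⧸ H) = p ^ (R₀ + 1) := by
    have key : ∀ i : ℕ, (QuotientGroup.mk γ : Hn ⧸ H) ^ i = 1 ↔ p ^ (R₀ + 1) ∣ i := fun i ↦ by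
      rw [← QuotientGroup.mk_pow, QuotientGroup.eq_one_iff, hmemH, SubgroupClass.coe_pow]
      exact hgi (R₀ + 1) i
    exact Nat.dvd_antisymm (orderOf_dvd_of_pow_eq_one ((key _).mpr dvd_rfl)) ((key _).mp (pow_orderOf_eq_one _))
  -- every `S_i(x)` lies in `A₁`
  have hSA : ∀ i : ℕ, geomSum (X := X) γ x i ∈ A₁ := fun i ↦ by
    induction i with
    | zero => rw [geomSum_zero]; exact A₁.zero_mem
    | succ i ih => rw [geomSum_succ, hXρpow]; exact A₁.add_mem ih (hstab _ _ hx)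
  -- the norm vanishes: `S_{p^(R₀+1)}(x) = 0`
  have hN : geomSum (X := X) γ x (orderOf (QuotientGroup.mk γ : Hn ⧸ H)) = 0 := by
    rw [hord]
    -- `p • S_{p^{R₀}}(x) = g^{p^{R₀}} y - y = 0`
    have hgR₀ : g ^ p ^ R₀ ∈ localSubgroup (κ.layerSubgroup (n + R₀)) K := (hgi R₀ _).mpr dvd_rfl
    have hpS : p • geomSum (X := X) γ x (p ^ R₀) = 0 := by
      rw [← geomSum_nsmul (X := X), hrel, ← hXρ γ y, geomSum_smul_sub_eq (X := X), hXρpow, hyR₀ _ hgR₀,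
        sub_self]
    -- hence `S_{p^{R₀}}(x) ∈ A₁[p]` is fixed by `g^{p^{R₀}}`, and `S_{p^{R₀+1}}(x) = p • S_{p^{R₀}}(x)`
    have hfix : X.ρ (γ ^ p ^ R₀) (geomSum (X := X) γ x (p ^ R₀)) = geomSum (X := X) γ x (p ^ R₀) := by
      rw [hXρpow]; exact hZ _ (hSA _) hpS _
    rw [pow_succ, geomSum_mul_eq_nsmul_of_apply_eq (X := X) γ x hfix p, hpS]
  -- translates of `x` are fixed by `H_{n+R₀+1}` (normality), hence so are the sums `S_i(x)`
  have hfixS : ∀ h ∈ localSubgroup (κ.layerSubgroup (n + (R₀ + 1))) K,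
      ∀ i : ℕ, h • geomSum (X := X) γ x i = geomSum (X := X) γ x i := by
    intro h hh i
    induction i with
    | zero => rw [geomSum_zero, smul_zero]
    | succ i ih =>
      rw [geomSum_succ, smul_add, ih, hXρpow]
      congr 1
      have hconj : (g ^ i)⁻¹ * h * (g ^ i) ∈ localSubgroup (κ.layerSubgroup (n + (R₀ + 1))) K := by
        have := hnormal.conj_mem h hh (g ^ i)⁻¹
        rwa [inv_inv] at this
      calc h • (g ^ i) • x = (g ^ i) • (((g ^ i)⁻¹ * h * g ^ i) • x) := by
            rw [← mul_smul, ← mul_smul]; congr 1; group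
        _ = (g ^ i) • x := by rw [hxR _ hconj]
  -- the cocycle `σ = g^i h ↦ S_i(x)`
  let f : Hn → P := fun σ ↦ geomSum (X := X) γ x (idxQ H γ hgenQ (σ : Hn ⧸ H))
  have hf_cont : Continuous f := by
    haveI : DiscreteTopology (Hn ⧸ H) := QuotientGroup.discreteTopology hHopen
    have hc : Continuous (fun q : Hn ⧸ H ↦ geomSum (X := X) γ x (idxQ H γ hgenQ q)) :=
      continuous_of_discreteTopology
    exact hc.comp QuotientGroup.continuous_mk
  -- `σ = g^{idx σ} · h` with `h ∈ H_{n+R₀+1}`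
  have hdec : ∀ σ : Hn, ((g ^ idxQ H γ hgenQ (σ : Hn ⧸ H))⁻¹ * (σ : absoluteGaloisGroup K)) ∈
      localSubgroup (κ.layerSubgroup (n + (R₀ + 1))) K := fun σ ↦ by
    have hh := pow_idxQ_inv_mul_mem H γ hgenQ σ
    rw [hmemH] at hh
    simpa only [Subgroup.coe_mul, Subgroup.coe_inv, SubgroupClass.coe_pow] using hh
  have hsplit : ∀ (σ : Hn) (m : P), (σ : absoluteGaloisGroup K) • m =
      (g ^ idxQ H γ hgenQ (σ : Hn ⧸ H)) • ((g ^ idxQ H γ hgenQ (σ : Hn ⧸ H))⁻¹ * (σ : absoluteGaloisGroup K)) • m :=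
    fun σ m ↦ by rw [← mul_smul, mul_inv_cancel_left]
  let c : contOneCocycles X := ⟨⟨f, hf_cont⟩, fun σ τ ↦ by
    change geomSum (X := X) γ x (idxQ H γ hgenQ ((σ * τ : Hn) : Hn ⧸ H)) =
      geomSum (X := X) γ x (idxQ H γ hgenQ (σ : Hn ⧸ H)) +
        X.ρ σ (geomSum (X := X) γ x (idxQ H γ hgenQ (τ : Hn ⧸ H)))
    rw [geomSum_eq_of_modEq (X := X) γ x hN (idxQ_mul_modEq H γ hgenQ σ τ), geomSum_add, hXρ σ, hsplit σ,
      hfixS _ (hdec σ), hXρpow]⟩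
  have hc_apply : ∀ σ : Hn, c.1 σ = geomSum (X := X) γ x (idxQ H γ hgenQ (σ : Hn ⧸ H)) := fun _ ↦ rfl
  refine ⟨c, fun σ hσ ↦ ?_, ?_, fun σ ↦ by rw [hc_apply]; exact hSA _, fun σ ↦ ?_⟩
  · -- vanishing on `H_∞ ⊆ H_{n+R₀+1}`: `idx σ ≡ 0`
    rw [hc_apply]
    have hσH : σ ∈ H := by
      rw [hmemH, mem_localSubgroup_iff]
      exact κ.kerSubgroup_le_layerSubgroup (n + (R₀ + 1)) ((mem_localSubgroup_iff _ _ _).mp hσ)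
    have h1 : (σ : Hn ⧸ H) = 1 := (QuotientGroup.eq_one_iff σ).mpr hσH
    have h0 : idxQ H γ hgenQ (σ : Hn ⧸ H) ≡ 0 [MOD orderOf (QuotientGroup.mk γ : Hn ⧸ H)] := by
      rw [← pow_eq_pow_iff_modEq, pow_zero, ← idxQ_spec H γ hgenQ (σ : Hn ⧸ H), h1]
    rw [geomSum_eq_of_modEq (X := X) γ x hN h0, geomSum_zero]
  · -- `c(g) = S_1(x) = x`
    rw [hc_apply]
    have h1 : idxQ H γ hgenQ (γ : Hn ⧸ H) ≡ 1 [MOD orderOf (QuotientGroup.mk γ : Hn ⧸ H)] := by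
      rw [← pow_eq_pow_iff_modEq, pow_one]
      exact (idxQ_spec H γ hgenQ (γ : Hn ⧸ H)).symm
    rw [geomSum_eq_of_modEq (X := X) γ x hN h1, geomSum_one]
  · -- `p • S_i(x) = S_i(g y - y) = g^i y - y = σ y - y`
    rw [hc_apply, ← geomSum_nsmul (X := X), hrel, ← hXρ γ y, geomSum_smul_sub_eq (X := X), hXρpow,
      hsplit σ y, hyR _ (hdec σ)]

end Literature.NumberTheory.EllipticCurves.Greenberg1999.GoodOrdTower

end Part4

/-!
## Part 5 — port of `Summits/BirchSwinnertonDyer/BirchSwinnertonDyer/Theorems/ByReductionTypeAtTwoGoodOrdTowerCoinvKummer.lean`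

# Route `ByReductionTypeAtTwo`, item `OrdKatoHalfAtTwo` (stmt-BirchSwinnertonDyer-19271), TOWER road, the
# GOOD-ORDINARY local constant at `v ∣ 2`: KERNEL BRICK G3 — Kummer on `E₁`: coinvariant `p`-torsion classes of the fixed
# module versus continuous characters of the local layer group `H_n`, at ANY prime `p`

HONEST FRAMING (cell `bsd-2adic`, run/shared/lean/pub/bsd-2adic/, seat `bsd-2adic-tower-1` GEN 11, HUMAN RULINGS
D-0036 / D-0054 / D-0074): TOOL theorem only (no definition, no named fact, no `sorry`); closes nothing by itself;
nothing booked; BSD is not proved by any of this. Third brick of the KERNELISATION of the consumed projection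
`#𝒦_{v,n}[2^∞][2] ≤ 4` of the PRINT binder `hS34 = Greenberg1999.lemma34_localTowerKerPrimary_cyclicExtension_rat`
(Greenberg, LNM 1716, §3 Lemma 3.4 / Prop. 2.5), scope memo HOME/tower/SCOPE-hS34-layer-kernel-at-2-GEN7.md §1 steps 2–3.
Setting of BRICK G2 (`…GoodOrdTowerCoinvCocycle.lean`): `p` any prime, `κ` cyclotomic, `v ∋ p`, `K = ℚ_v`, `Γ = Gal(K̄/K)`,
`H_n`, `H_∞`, `E(K̄_v) = localPoints W K`, `g ∈ H_n` a topological generator modulo `H_∞`, `A₁ ≤ E(K̄_v)` a `Γ`-stable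
`p`-DIVISIBLE subgroup (the formal group `E₁(K̄_v)` of good reduction, hypothesis (div₁) of the tree's layer-`0` proof of
Lemma 3.4) whose `p`-torsion `A₁[p] = ιZ(Z)` is fixed pointwise by `Γ` (automatic at `p = 2`: `#Ê[2] = 2`).

* **`natCard_torsionBy_coinv_mul_card_quotient_le_card_contHom`** — with `M₁ = A₁ ∩ E(K̄_v)^{H_∞}`, `D₁ = g − 1` on `M₁`,
  `Aₙ = A₁ ∩ E(K̄_v)^{H_n}`: if the continuous homomorphisms `H_n → Z` are finite in number then
  `#(M₁/D₁M₁)[p] · #(Aₙ/pAₙ) ≤ #Hom_cont(H_n, Z)` (with finiteness of both factors). Proof with explicit cocycles: a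
  `p`-torsion class `[x]`, `p x = D₁ y`, gives `χ = c − ∂ỹ` (`c` = BRICK G2's inflated cocycle, `p ỹ = y`), a continuous
  crossed homomorphism with values in the `Γ`-fixed `A₁[p]`, i.e. a continuous homomorphism `H_n → Z`; `b ∈ Aₙ` gives the
  Kummer character `κ(b) = ∂b̃`, `p b̃ = b`, with `ker κ = pAₙ`; and `[x] ↦ χ mod κ(Aₙ)` is injective (`χ − χ' = κ(b)` ⇒
  `a = ỹ' − ỹ − b̃ ∈ M₁` on `H_∞` and `x − x' = (g−1)(−a)` at `g`). This is the Kummer sequence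
  `Aₙ/p ↪ H¹(H_n, A₁[p]) ↠ H¹(H_n, A₁)[p]` composed with the inflation `(M₁/D₁M₁)[p] ↪ H¹(H_n, A₁)[p]`.

With BRICK G1 (`…CoinvDevissage`, the reduction-map dévissage) and BRICK 11 this reduces hS34's projection at `p = 2` to:
Hensel lifts `Ẽ(𝔽₂) → E(ℚ₂)`, `#Ẽ[2] ≤ 2`, the count `#Hom_cont(H_n, ℤ/2) = 2^{2^n+2}` (local Euler–Poincaré + `#H²(H_n, μ₂) = 2`)
and Lutz at the layer `#(E₁(L_n)/2) = 2^{2^n} · 2` (`L_n = K̄_v^{H_n}`) — the remaining bricks.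

References: R. Greenberg, LNM 1716 (1999), §3 Lemma 3.4 (p. 89) with Prop. 2.5 (p. 80); J.-P. Serre, *Local Fields*,
XIII §1; J. Silverman, *AEC* VIII §2 (Kummer pairing); scope memo §1.
-/

section Part5

set_option autoImplicit false

open scoped _root_.Classical

universe u

namespace Literature.NumberTheory.EllipticCurves.Greenberg1999.GoodOrdTower

open _root_.NumberField _root_.IsDedekindDomain _root_.Field _root_.PadicInt Literature.NumberTheory.EllipticCurves
  Literature.NumberTheory.GaloisRepresentations _root_.WeierstrassCurve

variable {p : ℕ} [Fact p.Prime] {κ : ZpExtension ℚ p}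

/-! ### The Kummer count: `#(A₁^{H_∞}/(g−1))[p] · #(A₁^{H_n}/p) ≤ #Hom_cont(H_n, A₁[p])` -/

/-- **Coinvariant `p`-torsion classes of the fixed module versus characters of `H_n` (Kummer on `E₁`).** Setting of
`exists_contOneCocycles_inflate`; moreover `A₁` is `p`-DIVISIBLE (hypothesis (div₁) of Greenberg's Lemma 3.4: the formal
group of good reduction over `K̄_v`) and its `p`-torsion `A₁[p]` is the image of an injective `ιZ : Z → E(K̄_v)` fixed
pointwise by `Γ`. Let `M₁ = A₁ ∩ E(K̄_v)^{H_∞}` with `D₁ = g − 1` on it, and `Aₙ = A₁ ∩ E(K̄_v)^{H_n}`. If the continuous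
homomorphisms `H_n → Z` are finite in number, then the `p`-torsion of `M₁/D₁M₁` and the quotient `Aₙ/pAₙ` are finite and
`#(M₁/D₁ M₁)[p] · #(Aₙ/p Aₙ) ≤ #Hom_cont(H_n, Z)`.
Proof: to a class `[x]` with `p x = D₁ y` attach `χ = c − ∂ỹ` (`c` the inflated cocycle of `exists_contOneCocycles_inflate`,
`p ỹ = y`): a continuous cocycle with values in the `Γ`-fixed `A₁[p] = ιZ(Z)`, i.e. a continuous homomorphism
`H_n → Z`; to `b ∈ Aₙ` attach the Kummer character `κ(b) = ∂b̃` (`p b̃ = b`), with `ker κ = pAₙ`; and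
`[x] ↦ χ mod κ(Aₙ)` is injective: `χ − χ' = κ(b)` forces `a = ỹ' − ỹ − b̃ ∈ M₁` (evaluate on `H_∞`) and
`x − x' = −(g a − a)` (evaluate at `g`). This is the Kummer sequence `A₁^{H_n}/p ↪ H¹(H_n, A₁[p]) ↠ H¹(H_n, A₁)[p]`
combined with the inflation `(A₁^{H_∞}/(g−1))[p] ↪ H¹(H_n, A₁)[p]`, written with explicit cocycles.
[cite: GreenbergLNM1716, §3 Lemma 3.4 (p. 89) with Prop. 2.5 (p. 80)] [cite: SerreLocalFields1979, XIII §1 Prop. 1] -/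
theorem natCard_torsionBy_coinv_mul_card_quotient_le_card_contHom (hκ : κ.IsCyclotomic)
    (v : HeightOneSpectrum (𝓞 ℚ)) (hv : ((p : ℕ) : 𝓞 ℚ) ∈ v.asIdeal) (W : WeierstrassCurve ℚ) (n : ℕ)
    {g : absoluteGaloisGroup (v.adicCompletion ℚ)}
    (hg : g ∈ localSubgroup (κ.layerSubgroup n) (v.adicCompletion ℚ))
    (hgen : ∀ U : Subgroup (absoluteGaloisGroup (v.adicCompletion ℚ)),
      IsOpen (U : Set (absoluteGaloisGroup (v.adicCompletion ℚ))) →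
        localSubgroup κ.kerSubgroup (v.adicCompletion ℚ) ≤ U → g ∈ U →
          localSubgroup (κ.layerSubgroup n) (v.adicCompletion ℚ) ≤ U)
    (A₁ : AddSubgroup (localPoints W (v.adicCompletion ℚ)))
    (hstab : ∀ (σ : absoluteGaloisGroup (v.adicCompletion ℚ)) (a : localPoints W (v.adicCompletion ℚ)),
      a ∈ A₁ → σ • a ∈ A₁)
    (hdiv₁ : ∀ a ∈ A₁, ∃ b ∈ A₁, p • b = a)
    {Z : Type} [AddCommGroup Z] [TopologicalSpace Z] [DiscreteTopology Z]
    (ιZ : Z →+ localPoints W (v.adicCompletion ℚ)) (hιZ : Function.Injective ιZ)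
    (hZr : ∀ a : localPoints W (v.adicCompletion ℚ), a ∈ A₁ ∧ p • a = 0 ↔ a ∈ ιZ.range)
    (hZfix : ∀ (σ : absoluteGaloisGroup (v.adicCompletion ℚ)) (z : Z), σ • ιZ z = ιZ z)
    (M₁ : AddSubgroup (localPoints W (v.adicCompletion ℚ)))
    (hM₁ : ∀ a, a ∈ M₁ ↔ a ∈ A₁ ∧ ∀ h ∈ localSubgroup κ.kerSubgroup (v.adicCompletion ℚ), h • a = a)
    (D₁ : M₁ →+ M₁) (hD₁ : ∀ a : M₁, ((D₁ a : M₁) : localPoints W (v.adicCompletion ℚ)) = g • (a : _) - a)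
    (Aₙ : AddSubgroup (localPoints W (v.adicCompletion ℚ)))
    (hAₙ : ∀ a, a ∈ Aₙ ↔ a ∈ A₁ ∧ ∀ σ ∈ localSubgroup (κ.layerSubgroup n) (v.adicCompletion ℚ), σ • a = a)
    [Finite {f : localSubgroup (κ.layerSubgroup n) (v.adicCompletion ℚ) → Z //
      Continuous f ∧ ∀ a b, f (a * b) = f a + f b}] :
    Finite {c : M₁ ⧸ D₁.range // p • c = 0} ∧
      Finite (Aₙ ⧸ (nsmulAddMonoidHom p : Aₙ →+ Aₙ).range) ∧
      Nat.card {c : M₁ ⧸ D₁.range // p • c = 0} * Nat.card (Aₙ ⧸ (nsmulAddMonoidHom p : Aₙ →+ Aₙ).range) ≤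
        Nat.card {f : localSubgroup (κ.layerSubgroup n) (v.adicCompletion ℚ) → Z //
          Continuous f ∧ ∀ a b, f (a * b) = f a + f b} := by
  -- notation
  let K := v.adicCompletion ℚ
  let P : Type := localPoints W K
  let Hn : Subgroup (absoluteGaloisGroup K) := localSubgroup (κ.layerSubgroup n) K
  let γ : Hn := ⟨g, hg⟩
  -- a left inverse of `ιZ`; `A₁[p] = ιZ(Z)` is fixed by `Γ`
  obtain ⟨linv, hlinv⟩ := hιZ.hasLeftInverse
  have hιlinv : ∀ a : P, a ∈ A₁ → p • a = 0 → ιZ (linv a) = a := fun a ha hpa ↦ by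
    obtain ⟨z, rfl⟩ := (hZr a).mp ⟨ha, hpa⟩
    rw [hlinv z]
  have hfixZ : ∀ a : P, a ∈ A₁ → p • a = 0 → ∀ σ : absoluteGaloisGroup K, σ • a = a := fun a ha hpa σ ↦ by
    obtain ⟨z, rfl⟩ := (hZr a).mp ⟨ha, hpa⟩
    exact hZfix σ z
  -- continuous homomorphisms `H_n → Z`, as an additive subgroup of `H_n → Z`
  let HomZ : AddSubgroup (Hn → Z) :=
    { carrier := {f | Continuous f ∧ ∀ a b, f (a * b) = f a + f b}
      zero_mem' := ⟨continuous_const, fun a b ↦ by simp⟩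
      add_mem' := fun {f f'} hf hf' ↦ ⟨hf.1.add hf'.1, fun a b ↦ by
        simp only [Pi.add_apply, hf.2 a b, hf'.2 a b]; abel⟩
      neg_mem' := fun {f} hf ↦ ⟨hf.1.neg, fun a b ↦ by simp only [Pi.neg_apply, hf.2 a b]; abel⟩ }
  have hmemHomZ : ∀ f : Hn → Z, f ∈ HomZ ↔ Continuous f ∧ ∀ a b, f (a * b) = f a + f b := fun _ ↦ Iff.rfl
  haveI hHomZfin : Finite HomZ := Finite.of_equiv _ (Equiv.subtypeEquivRight fun f ↦ (hmemHomZ f).symm)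
  have hcardHomZ : Nat.card {f : Hn → Z // Continuous f ∧ ∀ a b, f (a * b) = f a + f b} = Nat.card HomZ :=
    Nat.card_congr (Equiv.subtypeEquivRight fun f ↦ (hmemHomZ f).symm)
  -- a continuous `A₁[p]`-valued crossed homomorphism of `H_n` gives a continuous homomorphism `H_n → Z`
  have hmkHom : ∀ w : Hn → P, Continuous w → (∀ σ, w σ ∈ A₁ ∧ p • w σ = 0) →
      (∀ σ τ, w (σ * τ) = w σ + (σ : absoluteGaloisGroup K) • w τ) → linv ∘ w ∈ HomZ := by
    intro w hw hwZ hcoc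
    refine ⟨(((IsLocallyConstant.iff_continuous w).mpr hw).comp linv).continuous, fun σ τ ↦ hιZ ?_⟩
    rw [map_add, Function.comp_apply, Function.comp_apply, Function.comp_apply,
      hιlinv _ (hwZ _).1 (hwZ _).2, hιlinv _ (hwZ _).1 (hwZ _).2, hιlinv _ (hwZ _).1 (hwZ _).2, hcoc,
      hfixZ _ (hwZ τ).1 (hwZ τ).2]
  -- coboundaries `σ ↦ σ t - t` of elements `t ∈ A₁` with `p t` fixed by `H_n`
  have hcob : ∀ t : P, t ∈ A₁ → (∀ σ : Hn, (σ : absoluteGaloisGroup K) • (p • t) = p • t) →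
      (Continuous fun σ : Hn ↦ (σ : absoluteGaloisGroup K) • t - t) ∧
      (∀ σ : Hn, (σ : absoluteGaloisGroup K) • t - t ∈ A₁ ∧ p • ((σ : absoluteGaloisGroup K) • t - t) = 0) ∧
      (∀ σ τ : Hn, ((σ * τ : Hn) : absoluteGaloisGroup K) • t - t =
        ((σ : absoluteGaloisGroup K) • t - t) + (σ : absoluteGaloisGroup K) • ((τ : absoluteGaloisGroup K) • t - t)) := by
    intro t ht hpt
    refine ⟨((continuous_smul_localPoints W K t).comp continuous_subtype_val).sub continuous_const,
      fun σ ↦ ⟨A₁.sub_mem (hstab _ _ ht) ht, ?_⟩, fun σ τ ↦ ?_⟩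
    · rw [smul_sub, smul_comm, hpt σ, sub_self]
    · rw [Subgroup.coe_mul, mul_smul, smul_sub]; abel
  -- roots: `rt a ∈ A₁`, `p • rt a = a` for `a ∈ A₁`
  choose rt hrtA hrt using hdiv₁
  -- the root of `b ∈ Aₙ`
  have hAₙA : ∀ b : Aₙ, (b : P) ∈ A₁ := fun b ↦ ((hAₙ b).mp b.2).1
  have hrtfix : ∀ (b : Aₙ) (σ : Hn), (σ : absoluteGaloisGroup K) • (p • rt b (hAₙA b)) = p • rt b (hAₙA b) :=
    fun b σ ↦ by rw [hrt b (hAₙA b)]; exact ((hAₙ b).mp b.2).2 _ σ.2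
  -- the Kummer map `kum : Aₙ →+ HomZ`, `b ↦ (σ ↦ σ b̃ - b̃)`
  have hkmem : ∀ b : Aₙ, (linv ∘ fun σ : Hn ↦ (σ : absoluteGaloisGroup K) • rt b (hAₙA b) - rt b (hAₙA b)) ∈ HomZ :=
    fun b ↦ by
      obtain ⟨hc, hZ', hcoc⟩ := hcob _ (hrtA b (hAₙA b)) (hrtfix b)
      exact hmkHom _ hc hZ' hcoc
  -- independence of the root: `σ t - t` only depends on `p t` (two roots differ by a `Γ`-fixed element of `A₁[p]`)
  have hindep : ∀ (t t' : P), t ∈ A₁ → t' ∈ A₁ → p • t = p • t' →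
      ∀ σ : absoluteGaloisGroup K, σ • t - t = σ • t' - t' := by
    intro t t' ht ht' hp σ
    have hd : σ • (t - t') = t - t' :=
      hfixZ _ (A₁.sub_mem ht ht') (by rw [smul_sub, hp, sub_self]) σ
    rw [smul_sub] at hd
    exact sub_eq_sub_iff_sub_eq_sub.mp hd
  let kum : Aₙ →+ HomZ :=
    { toFun := fun b ↦ ⟨_, hkmem b⟩
      map_zero' := by
        refine Subtype.ext (funext fun σ ↦ hιZ ?_)
        change ιZ (linv ((σ : absoluteGaloisGroup K) • rt (0 : Aₙ) (hAₙA 0) - rt (0 : Aₙ) (hAₙA 0))) =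
          ιZ (((0 : HomZ) : Hn → Z) σ)
        rw [hιlinv _ (A₁.sub_mem (hstab _ _ (hrtA _ _)) (hrtA _ _))
          (by rw [smul_sub, smul_comm, hrtfix 0 σ, sub_self]),
          hindep _ 0 (hrtA _ _) A₁.zero_mem (by rw [hrt, smul_zero]; rfl) σ, smul_zero, sub_zero]
        exact (map_zero ιZ).symm
      map_add' := fun b b' ↦ by
        refine Subtype.ext (funext fun σ ↦ hιZ ?_)
        change ιZ (linv ((σ : absoluteGaloisGroup K) • rt _ (hAₙA (b + b')) - rt _ (hAₙA (b + b')))) =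
          ιZ (((linv ∘ fun σ : Hn ↦ (σ : absoluteGaloisGroup K) • rt b (hAₙA b) - rt b (hAₙA b)) σ) +
            ((linv ∘ fun σ : Hn ↦ (σ : absoluteGaloisGroup K) • rt b' (hAₙA b') - rt b' (hAₙA b')) σ))
        rw [map_add, Function.comp_apply, Function.comp_apply,
          hιlinv _ (A₁.sub_mem (hstab _ _ (hrtA _ _)) (hrtA _ _))
            (by rw [smul_sub, smul_comm, hrtfix _ σ, sub_self]),
          hιlinv _ (A₁.sub_mem (hstab _ _ (hrtA _ _)) (hrtA _ _))
            (by rw [smul_sub, smul_comm, hrtfix _ σ, sub_self]),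
          hιlinv _ (A₁.sub_mem (hstab _ _ (hrtA _ _)) (hrtA _ _))
            (by rw [smul_sub, smul_comm, hrtfix _ σ, sub_self]),
          hindep (rt _ (hAₙA (b + b'))) (rt b (hAₙA b) + rt b' (hAₙA b')) (hrtA _ _)
            (A₁.add_mem (hrtA _ _) (hrtA _ _)) (by rw [hrt, smul_add, hrt, hrt]; rfl) σ,
          smul_add]
        abel }
  have hkum_apply : ∀ (b : Aₙ) (σ : Hn),
      ιZ (((kum b : HomZ) : Hn → Z) σ) = (σ : absoluteGaloisGroup K) • rt b (hAₙA b) - rt b (hAₙA b) := fun b σ ↦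
    hιlinv _ (A₁.sub_mem (hstab _ _ (hrtA _ _)) (hrtA _ _)) (by rw [smul_sub, smul_comm, hrtfix _ σ, sub_self])
  -- `ker kum = p Aₙ`
  have hker : kum.ker = (nsmulAddMonoidHom p : Aₙ →+ Aₙ).range := by
    ext b
    rw [AddMonoidHom.mem_ker, AddMonoidHom.mem_range]
    constructor
    · intro hb
      -- `σ b̃ = b̃` for all `σ ∈ H_n`, so `b̃ ∈ Aₙ` and `b = p b̃`
      have hfix : ∀ σ : Hn, (σ : absoluteGaloisGroup K) • rt b (hAₙA b) = rt b (hAₙA b) := fun σ ↦ by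
        have h := hkum_apply b σ
        rw [hb] at h
        change ιZ (((0 : HomZ) : Hn → Z) σ) = _ at h
        rw [show ((0 : HomZ) : Hn → Z) σ = 0 from rfl, map_zero] at h
        exact (sub_eq_zero.mp h.symm)
      refine ⟨⟨rt b (hAₙA b), (hAₙ _).mpr ⟨hrtA _ _, fun σ hσ ↦ hfix ⟨σ, hσ⟩⟩⟩, Subtype.ext ?_⟩
      change p • rt b (hAₙA b) = b
      exact hrt b (hAₙA b)
    · rintro ⟨a, rfl⟩
      refine Subtype.ext (funext fun σ ↦ hιZ ?_)
      rw [hkum_apply]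
      change (σ : absoluteGaloisGroup K) • rt _ (hAₙA (p • a)) - rt _ (hAₙA (p • a)) = ιZ (((0 : HomZ) : Hn → Z) σ)
      rw [show ((0 : HomZ) : Hn → Z) σ = 0 from rfl, map_zero,
        hindep _ (a : P) (hrtA _ _) (hAₙA a) (by rw [hrt]; rfl) σ, ((hAₙ a).mp a.2).2 _ σ.2, sub_self]
  -- `#(Aₙ/pAₙ) = #range kum`
  have hcardK : Nat.card (Aₙ ⧸ (nsmulAddMonoidHom p : Aₙ →+ Aₙ).range) = Nat.card kum.range := by
    rw [← hker]
    exact Nat.card_congr (QuotientAddGroup.quotientKerEquivRange kum).toEquiv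
  haveI hKfin : Finite kum.range := inferInstance
  -- the map `Φ : (M₁/D₁M₁)[p] → HomZ ⧸ range kum`
  have hM₁A : ∀ x : M₁, (x : P) ∈ A₁ := fun x ↦ ((hM₁ x).mp x.2).1
  have hM₁i : ∀ x : M₁, ∀ h ∈ localSubgroup κ.kerSubgroup K, h • (x : P) = x := fun x ↦ ((hM₁ x).mp x.2).2
  -- representatives and the relation `p x = g y - y`
  have hrep : ∀ c : {c : M₁ ⧸ D₁.range // p • c = 0}, ∃ x y : M₁,
      (QuotientAddGroup.mk x : M₁ ⧸ D₁.range) = c.1 ∧ p • (x : P) = g • (y : P) - y := by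
    intro c
    obtain ⟨x, hx⟩ := QuotientAddGroup.mk_surjective c.1
    have hpx : (QuotientAddGroup.mk (p • x) : M₁ ⧸ D₁.range) = 0 := by rw [QuotientAddGroup.mk_nsmul, hx]; exact c.2
    rw [QuotientAddGroup.eq_zero_iff] at hpx
    obtain ⟨y, hy⟩ := hpx
    refine ⟨x, y, hx, ?_⟩
    rw [← hD₁ y, hy, AddSubgroup.coe_nsmul]
  choose xr yr hxr hrel using hrep
  -- the inflated cocycles
  have hcoc : ∀ c : {c : M₁ ⧸ D₁.range // p • c = 0}, ∃ cc : contOneCocycles (discreteTopRep Hn P),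
      (∀ σ : Hn, (σ : absoluteGaloisGroup K) ∈ localSubgroup κ.kerSubgroup K → cc.1 σ = 0) ∧
      cc.1 γ = (xr c : P) ∧ (∀ σ : Hn, cc.1 σ ∈ A₁) ∧
      (∀ σ : Hn, p • cc.1 σ = (σ : absoluteGaloisGroup K) • (yr c : P) - yr c) := fun c ↦
    exists_contOneCocycles_inflate hκ v hv W n hg hgen A₁ hstab (fun a ha hpa σ ↦ hfixZ a ha hpa σ)
      (hM₁A (xr c)) (hM₁i (xr c)) (hM₁i (yr c)) (hrel c)
  choose cc hcc0 hccγ hccA hccp using hcoc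
  -- `χ_c = cc - ∂ỹ` with `ỹ = rt y`: a continuous `A₁[p]`-valued crossed homomorphism of `H_n`
  have hchi : ∀ c : {c : M₁ ⧸ D₁.range // p • c = 0},
      (linv ∘ fun σ : Hn ↦ (cc c).1 σ -
        ((σ : absoluteGaloisGroup K) • rt (yr c : P) (hM₁A (yr c)) - rt (yr c : P) (hM₁A (yr c)))) ∈ HomZ := by
    intro c
    refine hmkHom _ (((cc c).1.continuous).sub
      (((continuous_smul_localPoints W K _).comp continuous_subtype_val).sub continuous_const))
      (fun σ ↦ ⟨A₁.sub_mem (hccA c σ) (A₁.sub_mem (hstab _ _ (hrtA _ _)) (hrtA _ _)), ?_⟩) (fun σ τ ↦ ?_)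
    · rw [smul_sub, hccp c σ, smul_sub, smul_comm, hrt, sub_self]
    · have h1 := (cc c).2 σ τ
      change (cc c).1 (σ * τ) = (cc c).1 σ + (σ : absoluteGaloisGroup K) • (cc c).1 τ at h1
      rw [h1, Subgroup.coe_mul, mul_smul, smul_sub, smul_sub]
      abel
  let chi : {c : M₁ ⧸ D₁.range // p • c = 0} → HomZ := fun c ↦ ⟨_, hchi c⟩
  have hchi_apply : ∀ (c : {c : M₁ ⧸ D₁.range // p • c = 0}) (σ : Hn),
      ιZ (((chi c : HomZ) : Hn → Z) σ) = (cc c).1 σ -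
        ((σ : absoluteGaloisGroup K) • rt (yr c : P) (hM₁A (yr c)) - rt (yr c : P) (hM₁A (yr c))) := fun c σ ↦
    hιlinv _ (A₁.sub_mem (hccA c σ) (A₁.sub_mem (hstab _ _ (hrtA _ _)) (hrtA _ _)))
      (by rw [smul_sub, hccp c σ, smul_sub, smul_comm, hrt, sub_self])
  -- `Φ c = χ_c mod range kum` is injective
  let Φ : {c : M₁ ⧸ D₁.range // p • c = 0} → HomZ ⧸ kum.range := fun c ↦ QuotientAddGroup.mk (chi c)
  have hΦ : Function.Injective Φ := by
    intro c c' hcc'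
    have hmem : chi c - chi c' ∈ kum.range := by
      rw [← QuotientAddGroup.eq_iff_sub_mem]
      exact hcc'
    obtain ⟨b, hb⟩ := hmem
    -- the values: `χ_c σ - χ_{c'} σ = σ b̃ - b̃`
    have hval : ∀ σ : Hn, ((cc c).1 σ - ((σ : absoluteGaloisGroup K) • rt (yr c : P) (hM₁A (yr c)) -
        rt (yr c : P) (hM₁A (yr c)))) - ((cc c').1 σ - ((σ : absoluteGaloisGroup K) •
          rt (yr c' : P) (hM₁A (yr c')) - rt (yr c' : P) (hM₁A (yr c')))) =
        (σ : absoluteGaloisGroup K) • rt b (hAₙA b) - rt b (hAₙA b) := by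
      intro σ
      have h : ιZ (((kum b : HomZ) : Hn → Z) σ) = ιZ (((chi c - chi c' : HomZ) : Hn → Z) σ) := by rw [hb]
      rw [hkum_apply, AddSubgroup.coe_sub, Pi.sub_apply, map_sub, hchi_apply, hchi_apply] at h
      exact h.symm
    -- on `H_∞`: `a = ỹ' - ỹ - b̃` is fixed, hence `a ∈ M₁`
    set a : P := rt (yr c' : P) (hM₁A (yr c')) - rt (yr c : P) (hM₁A (yr c)) - rt b (hAₙA b) with ha_def
    have haA : a ∈ A₁ := A₁.sub_mem (A₁.sub_mem (hrtA _ _) (hrtA _ _)) (hrtA _ _)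
    have hafix : ∀ h ∈ localSubgroup κ.kerSubgroup K, h • a = a := by
      intro h hh
      have hhn : h ∈ Hn := localSubgroup_ker_le_layer κ K n hh
      have e := hval ⟨h, hhn⟩
      rw [hcc0 c ⟨h, hhn⟩ hh, hcc0 c' ⟨h, hhn⟩ hh, zero_sub, zero_sub] at e
      change -(h • rt (yr c : P) (hM₁A (yr c)) - rt (yr c : P) (hM₁A (yr c))) -
        -(h • rt (yr c' : P) (hM₁A (yr c')) - rt (yr c' : P) (hM₁A (yr c'))) =
          h • rt b (hAₙA b) - rt b (hAₙA b) at e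
      rw [ha_def, smul_sub, smul_sub]
      -- linear rearrangement of `e`
      have e' := sub_eq_zero.mpr e
      rw [← sub_eq_zero]
      rw [← e']
      abel
    have haM : a ∈ M₁ := (hM₁ a).mpr ⟨haA, hafix⟩
    -- at `g`: `x - x' = g (-a) - (-a)`
    have eγ := hval γ
    rw [hccγ c, hccγ c'] at eγ
    change (xr c : P) - (g • rt (yr c : P) (hM₁A (yr c)) - rt (yr c : P) (hM₁A (yr c))) -
      ((xr c' : P) - (g • rt (yr c' : P) (hM₁A (yr c')) - rt (yr c' : P) (hM₁A (yr c')))) =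
        g • rt b (hAₙA b) - rt b (hAₙA b) at eγ
    have hxx : (xr c : P) - xr c' = g • (-a) - (-a) := by
      have e' := sub_eq_zero.mpr eγ
      rw [← sub_eq_zero, ← e', ha_def]
      simp only [smul_sub, smul_neg]
      abel
    have hD : xr c - xr c' = D₁ ⟨-a, M₁.neg_mem haM⟩ := by
      refine Subtype.ext ?_
      rw [AddSubgroup.coe_sub, hD₁]
      exact hxx
    apply Subtype.ext
    rw [← hxr c, ← hxr c', QuotientAddGroup.eq_iff_sub_mem, hD]
    exact ⟨_, rfl⟩
  -- counting
  haveI : Finite (HomZ ⧸ kum.range) := inferInstance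
  have h1 : Nat.card {c : M₁ ⧸ D₁.range // p • c = 0} ≤ Nat.card (HomZ ⧸ kum.range) :=
    Nat.card_le_card_of_injective Φ hΦ
  have h2 : Nat.card HomZ = Nat.card (HomZ ⧸ kum.range) * Nat.card kum.range :=
    AddSubgroup.card_eq_card_quotient_mul_card_addSubgroup _
  refine ⟨Finite.of_injective Φ hΦ, ?_, ?_⟩
  · rw [← hker]
    exact Finite.of_equiv _ (QuotientAddGroup.quotientKerEquivRange kum).toEquiv.symm
  · rw [hcardHomZ, h2, hcardK]
    exact Nat.mul_le_mul_right _ h1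

end Literature.NumberTheory.EllipticCurves.Greenberg1999.GoodOrdTower

end Part5

/-!
## Part 6 — port of `Summits/BirchSwinnertonDyer/Rank1Residual/Additive/LocalZpExtension.lean`

# The LOCAL `ℤ_p`-extension at a place that does not split completely: `Γ_{K_v} ↠ ℤ_p` with kernel
# `Gal(K̄_v/K_∞·K_v)` and a topological generator (cell `b2b-bsdres`, CLASS-CLOSURE lane, class O10
# — x1b GEN 35, class lead; file 51 of the series: brick B4 of the GLOBAL count (C), part 2 — the
# device that turns local-tower questions at `v` into `ZpExtension` questions over `K_v`)

HONEST FRAMING (cell `b2b-bsdres`, run/shared/lean/b2b/bsd-rank1-residual/, verbatim in every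
file): the goal of the cell is to DELETE the COMBINATION-SHAPED residual classes of the
Birch–Swinnerton-Dyer formula for ALL analytic-rank `≤ 1` elliptic curves over `ℚ` — "full BSD
formula for every rank `≤ 1` curve in class `C`" assembled STRICTLY from published theorems — so
that the rank-`≤ 1` remainder becomes exactly the CONSTRUCTION-SHAPED classes, which are TYPED
(missing-input `Prop`s), NOT attempted. This is not "finishing BSD". CLASS-CLOSURE lane: prove
what is provable now; shrink each hard class to its core with data; no claim beyond stated classes;
research routes on CONSTRUCTION-SHAPED X12 / O10; census / instrument output = EVIDENCE / conjecture
items, NEVER a Literature fact; `RESIDUAL-MAP.md` marks change only by signed lines. THIS FILE: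
ONE TOOL THEOREM (an existence statement over the tree's `ZpExtension` / `localSubgroup`
vocabulary; the witness is built inside the proof) — no definition, no named Literature fact, no
Summits-side fact `def … : Prop`, no `sorry`, axioms standard; nothing is booked; no label / mark /
count / sub-cell moves; O10 stays OPEN / CONSTRUCTION-SHAPED; nothing about `BSD(W, p)` of any pair
is claimed.

## What (brick B4 of `B2-LOCALISATION-x1b.md` §3, step (ii): the device)

For a `ℤ_p`-extension `κ : Γ_K ↠ ℤ_p` and a `K`-field `E` (a completion `K_v`) whose restriction
`Γ_E → Γ_K` does NOT land in `ker κ` (the place does not split completely in `K_∞/K`), the image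
of `Γ_E` under `κ ∘ res` is a non-zero closed subgroup `pᵐℤ_p` of `ℤ_p`; rescaling by a generator
`x₀ = κ(res g)` of maximal norm gives a SURJECTIVE continuous homomorphism
`κ_E = x₀⁻¹·(κ ∘ res) : Γ_E ↠ ℤ_p`, i.e. a `ZpExtension E p`, with
`ker κ_E = (Γ_E → Γ_K)⁻¹(ker κ) = Gal(K̄_E/K_∞·E)` (`localSubgroup κ.kerSubgroup E`) and topological
generator `g` (`κ_E g = 1`). **`exists_localZpExtension`**. Consequence: every tree theorem about
`ℤ_p`-extensions of a field (`kerLayerToInftyEquiv`, `exists_cocycle_vanishing_apply_eq`,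
`layerSubgroup_eq_top_of_isOpen`, …) applies to the local tower `K_{v,∞} = K_∞·K_v / K_v`; this is how
Greenberg treats `Γ_v = Gal(K_{v,∞}/K_v) ≅ ℤ_p` in LNM 1716 §3 (Lemmas 3.3–3.4: "`K_η` is the
unramified `ℤ_p`-extension of `F_v`", p. 87) and how the surjectivity half of
`𝒦_{v,0}[p^∞] ≅ B/(γ_v − 1)B` (B4 step (ii)) is to be obtained.

References: [GreenbergLNM1716] R. Greenberg, LNM 1716 (1999), §3 pp. 86–88; [Washington1997] §13.1
(closed subgroups of `ℤ_p`); [SerreGaloisCohomology1997] II.§1.1.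
-/

section Part6


open scoped _root_.Classical

universe u

namespace Literature.NumberTheory.EllipticCurves.Greenberg1999.Rank1ResidualAdditive

open Literature.NumberTheory.EllipticCurves Literature.NumberTheory.GaloisRepresentations ZpExtension

variable {K : Type u} [Field K] {p : ℕ} [hp : Fact p.Prime] (κ : ZpExtension K p)
  (E : Type u) [Field E] [Algebra K E]

/-- **The local `ℤ_p`-extension at a non-split place.** If some `δ ∈ Γ_E` restricts outside
`ker κ`, there is a `ℤ_p`-extension `κ_E` of `E` whose kernel is `Gal(K̄_E/K_∞·E) = res⁻¹(ker κ)`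
and which has a topological generator `g ∈ Γ_E` (`κ_E g = 1`); moreover `κ_E` is `κ ∘ res`
rescaled: `κ(res σ) = κ_E(σ) · κ(res g)` (additively) for all `σ`. Construction: `x₀ = κ(res g)` of
MAXIMAL norm over the compact `Γ_E` (`IsCompact.exists_isMaxOn`); then `κ(res σ)/x₀ ∈ ℤ_p` for all
`σ`, the rescaled map is a continuous homomorphism with `g ↦ 1`, and its image is a closed subgroup
of `ℤ_p` containing `ℤ`, hence everything (`PadicInt.denseRange_intCast`).
[cite: GreenbergLNM1716, §3 p. 87] [cite: Washington1997, §13.1] -/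
theorem exists_localZpExtension
    (hE : ∃ δ : Field.absoluteGaloisGroup E, resGal (K := K) E δ ∉ κ.kerSubgroup) :
    ∃ (κE : ZpExtension E p) (g : Field.absoluteGaloisGroup E),
      κE.kerSubgroup = localSubgroup κ.kerSubgroup E ∧ κE.IsTopGenerator g ∧
        ∀ σ : Field.absoluteGaloisGroup E,
          (κ (resGal (K := K) E σ)).toAdd = (κE σ).toAdd * (κ (resGal (K := K) E g)).toAdd := by
  haveI : CompactSpace (Field.absoluteGaloisGroup E) := absoluteGaloisGroup_compactSpace E
  -- the additive coordinate `a σ = κ(res σ) ∈ ℤ_p` and its norm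
  let a : Field.absoluteGaloisGroup E → ℤ_[p] := fun σ ↦ (κ (resGal (K := K) E σ)).toAdd
  have ha_cont : Continuous a :=
    continuous_toAdd.comp ((map_continuous κ).comp (map_continuous (resGal (K := K) E)))
  have ha_mul : ∀ σ τ, a (σ * τ) = a σ + a τ := fun σ τ ↦ by
    simp only [a, map_mul, toAdd_mul]
  have ha_one : a 1 = 0 := by simp only [a, map_one, toAdd_one]
  have ha_inv : ∀ σ, a σ⁻¹ = -a σ := fun σ ↦ by
    have h := ha_mul σ σ⁻¹
    rw [mul_inv_cancel, ha_one] at h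
    linear_combination -h
  -- an element `g` of maximal norm
  obtain ⟨g, -, hg⟩ := (isCompact_univ (X := Field.absoluteGaloisGroup E)).exists_isMaxOn
    Set.univ_nonempty ((continuous_norm.comp ha_cont).continuousOn)
  have hmax : ∀ σ, ‖a σ‖ ≤ ‖a g‖ := fun σ ↦ hg (Set.mem_univ σ)
  set x₀ : ℤ_[p] := a g with hx₀def
  have hx₀ : x₀ ≠ 0 := by
    obtain ⟨δ, hδ⟩ := hE
    intro h0
    have hδ0 : a δ ≠ 0 := fun h ↦ hδ (by
      rw [ZpExtension.mem_kerSubgroup]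
      exact Multiplicative.toAdd.injective (by rw [toAdd_one]; exact h))
    have := hmax δ
    rw [h0, norm_zero] at this
    exact hδ0 (norm_le_zero_iff.mp this)
  have hx₀' : (x₀ : ℚ_[p]) ≠ 0 := PadicInt.coe_ne_zero.mpr hx₀
  -- the rescaled coordinate `y σ = a σ / x₀ ∈ ℤ_p`
  have hnorm : ∀ σ, ‖(a σ : ℚ_[p]) / (x₀ : ℚ_[p])‖ ≤ 1 := fun σ ↦ by
    rw [norm_div, PadicInt.padic_norm_e_of_padicInt, PadicInt.padic_norm_e_of_padicInt]
    exact div_le_one_of_le₀ (hmax σ) (norm_nonneg _)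
  let y : Field.absoluteGaloisGroup E → ℤ_[p] := fun σ ↦ ⟨(a σ : ℚ_[p]) / (x₀ : ℚ_[p]), hnorm σ⟩
  have hy_coe : ∀ σ, ((y σ : ℤ_[p]) : ℚ_[p]) = (a σ : ℚ_[p]) / (x₀ : ℚ_[p]) := fun _ ↦ rfl
  have hy_mul : ∀ σ τ, y (σ * τ) = y σ + y τ := fun σ τ ↦ by
    apply Subtype.ext
    change (a (σ * τ) : ℚ_[p]) / (x₀ : ℚ_[p]) = (a σ : ℚ_[p]) / x₀ + (a τ : ℚ_[p]) / x₀
    rw [ha_mul, PadicInt.coe_add, add_div]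
  have hy_one : y 1 = 0 := by
    apply Subtype.ext
    change (a 1 : ℚ_[p]) / (x₀ : ℚ_[p]) = 0
    rw [ha_one, PadicInt.coe_zero, zero_div]
  have hy_g : y g = 1 := by
    apply Subtype.ext
    change (a g : ℚ_[p]) / (x₀ : ℚ_[p]) = 1
    rw [← hx₀def, div_self hx₀']
  have hy_cont : Continuous y :=
    ((continuous_subtype_val.comp ha_cont).div_const _).subtype_mk _
  have hy_x₀ : ∀ σ, a σ = y σ * x₀ := fun σ ↦ by
    apply Subtype.ext
    rw [PadicInt.coe_mul]
    change (a σ : ℚ_[p]) = (a σ : ℚ_[p]) / x₀ * x₀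
    rw [div_mul_cancel₀ _ hx₀']
  -- the rescaled continuous homomorphism `Γ_E →ₜ* ℤ_p`
  let φ : Field.absoluteGaloisGroup E →ₜ* Multiplicative ℤ_[p] :=
    { toFun := fun σ ↦ Multiplicative.ofAdd (y σ)
      map_one' := by rw [hy_one, ofAdd_zero]
      map_mul' := fun σ τ ↦ by rw [hy_mul, ofAdd_add]
      continuous_toFun := continuous_ofAdd.comp hy_cont }
  have hφ : ∀ σ, φ σ = Multiplicative.ofAdd (y σ) := fun _ ↦ rfl
  have hφg : φ g = Multiplicative.ofAdd 1 := by rw [hφ, hy_g]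
  -- surjectivity: the image is a closed subgroup of `ℤ_p` containing `ℤ`
  have hsurj : Function.Surjective φ := by
    have hclosed : IsClosed (Set.range φ) := (isCompact_range φ.continuous_toFun).isClosed
    have hsub : Set.range (fun n : ℤ ↦ Multiplicative.ofAdd ((n : ℤ) : ℤ_[p])) ⊆ Set.range φ := by
      rintro _ ⟨n, rfl⟩
      refine ⟨g ^ n, ?_⟩
      rw [map_zpow, hφg, ← ofAdd_zsmul, zsmul_eq_mul, mul_one]
    have hdense : DenseRange (fun n : ℤ ↦ Multiplicative.ofAdd ((n : ℤ) : ℤ_[p])) :=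
      (Multiplicative.ofAdd.surjective.denseRange).comp PadicInt.denseRange_intCast continuous_ofAdd
    have huniv : Set.range φ = Set.univ := by
      have hd : Dense (Set.range φ) := hdense.mono hsub
      rw [← hclosed.closure_eq, hd.closure_eq]
    intro x
    have hx : x ∈ Set.range φ := by rw [huniv]; exact Set.mem_univ x
    exact hx
  refine ⟨⟨φ, hsurj⟩, g, ?_, hφg, fun σ ↦ hy_x₀ σ⟩
  -- the kernel is `res⁻¹(ker κ)`
  ext σ
  rw [ZpExtension.mem_kerSubgroup, mem_localSubgroup_iff, ZpExtension.mem_kerSubgroup]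
  change φ σ = 1 ↔ _
  rw [hφ]
  constructor
  · intro h
    have hy0 : y σ = 0 := Multiplicative.ofAdd.injective (by rw [h, ofAdd_zero])
    have ha0 : a σ = 0 := by rw [hy_x₀ σ, hy0, zero_mul]
    exact Multiplicative.toAdd.injective (by rw [toAdd_one]; exact ha0)
  · intro h
    have ha0 : a σ = 0 := by
      change (κ (resGal (K := K) E σ)).toAdd = 0
      rw [h, toAdd_one]
    have hy0 : y σ = 0 := by
      apply Subtype.ext
      change (a σ : ℚ_[p]) / (x₀ : ℚ_[p]) = 0
      rw [ha0, PadicInt.coe_zero, zero_div]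
    rw [hy0, ofAdd_zero]

end Literature.NumberTheory.EllipticCurves.Greenberg1999.Rank1ResidualAdditive

end Part6

/-!
## Part 7 — port of `Summits/BirchSwinnertonDyer/BirchSwinnertonDyer/Theorems/ByReductionTypeAtTwoGoodOrdTowerControlCocycle.lean`

# Route `ByReductionTypeAtTwo`, item `OrdKatoHalfAtTwo` (stmt-BirchSwinnertonDyer-19271), TOWER road, the
# GOOD-ORDINARY local tower kernels at `v ∣ 2` at FULL `2`-power depth: BRICK B, part 1 — the inflated cocycle of a
# `p^k`-torsion coinvariant class

HONEST FRAMING (cell `bsd-2adic`, run/shared/lean/pub/bsd-2adic/, seat `bsd-2adic-tower-1` GEN 20, HUMAN RULINGS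
D-0036 / D-0054 / D-0074): TOOL theorems only (no definition, no named fact, no `sorry`); closes nothing by itself;
nothing booked; BSD is not proved by any of this. Brick B of the programme «UNIFORM layer bound
`∃ C, ∀ n, #𝒦_{v,n}[2^∞] ≤ C` at a good ordinary `2` over `ℚ`» ⇒ `WeierstrassCurve.Greenberg1999_kerG_bounded` at `p = 2`
⇒ Mazur's control theorem `WeierstrassCurve.selmer_control` over `ℚ` at `p = 2` (Greenberg, LNM 1716, Thm. 1.2). It is
the depth-`p^k` form of GEN 11's BRICKS G2/G3 (`…GoodOrdTowerCoinvCocycle.lean`, `…GoodOrdTowerCoinvKummer.lean`), whose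
depth-`p` form used that `Ê[p]` is fixed by `Γ` (automatic at `p = 2`); at depth `p^k`, `k ≥ 2`, the torsion `Ê[p^k]` is
NOT Galois-trivial, so the crossed homomorphisms become genuine continuous `1`-cocycles of the discrete `H_n`-module
`Z ≅ Ê[p^k]` and the count is against `#H¹(H_n, Z)` (Mathlib's continuous cohomology of `discreteTopRep H_n Z`).
Setting (as in G2/G3): `p` any prime, `κ` cyclotomic, `v ∋ p`, `K = ℚ_v`, `Γ = Gal(K̄/K)`, `H_n`, `H_∞`, `E(K̄_v) = localPoints W K`,
`g ∈ H_n` a topological generator modulo `H_∞`, `A₁ ≤ E(K̄_v)` a `Γ`-stable subgroup (`E₁(K̄_v) = Ê(𝔪̄)`).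

* `exists_contOneCocycles_inflate_pow` — G2 at depth `p^k`: for `x ∈ A₁`, `y` fixed by `H_∞` with `p^k x = g y − y`, if the
  `p^k`-torsion of `A₁` is fixed pointwise by some layer group `H_{m₀}` (finite level — `Ê[p^k]` is finite), there is a
  continuous `1`-cocycle `c` of `H_n` with values in `A₁`, vanishing on `H_∞`, `c(g) = x`, `p^k c(σ) = σ y − y`.
* `natCard_torsionBy_coinv_mul_card_quotient_le_card_H1` — G3 at depth `p^k`: with `M₁ = A₁ ∩ E(K̄_v)^{H_∞}`, `D₁ = g − 1`,
  `Aₙ = A₁ ∩ E(K̄_v)^{H_n}`, `A₁` `p^k`-divisible, and `Z` a discrete `Γ`-module mapped by an injective EQUIVARIANT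
  `ιZ : Z → E(K̄_v)` onto `A₁[p^k]`: if `H¹(H_n, Z)` is finite then `#(M₁/D₁M₁)[p^k] · #(Aₙ/p^k Aₙ) ≤ #H¹(H_n, Z)` (with
  finiteness). Proof as G3 but in `H¹`: the Kummer map `Aₙ → H¹(H_n, Z)`, `b ↦ [∂b̃]` (`p^k b̃ = b`; the class does not
  depend on the root), has kernel `p^k Aₙ`; `[x] ↦ [c − ∂ỹ] mod κ(Aₙ)` is injective (`χ − χ' = κ(b) + ∂t` forces
  `a = ỹ' − ỹ − b̃ − t ∈ M₁` on `H_∞` and `x − x' = (g − 1)(−a)` at `g`).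

References: R. Greenberg, LNM 1716 (1999), §3 Lemma 3.1 (p. 86), Lemma 3.4 (p. 89) with Prop. 2.5 (p. 80); J.-P. Serre,
*Local Fields*, XIII §1 Prop. 1; J. Silverman, *AEC* VIII §2 (Kummer pairing).
-/

section Part7

set_option autoImplicit false

open scoped _root_.Classical

universe u

namespace Literature.NumberTheory.EllipticCurves.Greenberg1999.GoodOrdTower

open _root_.NumberField _root_.IsDedekindDomain _root_.Field _root_.PadicInt Literature.NumberTheory.EllipticCurves
  Literature.NumberTheory.GaloisRepresentations _root_.WeierstrassCurve

variable {p : ℕ} [Fact p.Prime] {κ : ZpExtension ℚ p}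

/-! ### The inflated cocycle of a `p^k`-torsion coinvariant class -/

/-- **The inflated cocycle of a `p^k`-torsion coinvariant class** (BRICK G2 at depth `p^k`). Let `A₁ ≤ E(K̄_v)` be a
`Γ`-stable subgroup whose `p^k`-torsion elements are fixed by the layer group `H_{m₀}` (a finite level: `Ê[p^k]` is finite),
`g ∈ H_n` a topological generator of `H_n` modulo `H_∞`, and `x ∈ A₁`, `y ∈ E(K̄_v)` fixed by `H_∞` with `p^k x = g y − y`.
Then there is a continuous `1`-cocycle `c` of `H_n` with values in `E(K̄_v)` vanishing on `H_∞`, with `c(g) = x`,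
`c(σ) ∈ A₁` and `p^k c(σ) = σ y − y` for every `σ ∈ H_n`. Construction as in G2: `x`, `y` and `A₁[p^k]` are fixed by some
`H_{n+R₀}`; the geometric sums `S_i(x) = Σ_{j<i} g^j x` satisfy `S_{p^{R₀+k}}(x) = p^k S_{p^{R₀}}(x) = 0`
(`p^k S_{p^{R₀}}(x) = g^{p^{R₀}} y − y = 0`, so `S_{p^{R₀}}(x) ∈ A₁[p^k]` is fixed by `g^{p^{R₀}}`), hence
`σ = g^i h ↦ S_i(x)` (`h ∈ H_{n+R₀+k}`) is a cocycle of the cyclic quotient `H_n/H_{n+R₀+k}`, inflated to `H_n`.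
[cite: GreenbergLNM1716, §3 Lemma 3.1 (p. 86)] [cite: SerreLocalFields1979, XIII §1 Prop. 1] -/
theorem exists_contOneCocycles_inflate_pow (hκ : κ.IsCyclotomic) (v : HeightOneSpectrum (𝓞 ℚ))
    (hv : ((p : ℕ) : 𝓞 ℚ) ∈ v.asIdeal) (W : WeierstrassCurve ℚ) (n k m₀ : ℕ)
    {g : absoluteGaloisGroup (v.adicCompletion ℚ)}
    (hg : g ∈ localSubgroup (κ.layerSubgroup n) (v.adicCompletion ℚ))
    (hgen : ∀ U : Subgroup (absoluteGaloisGroup (v.adicCompletion ℚ)),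
      IsOpen (U : Set (absoluteGaloisGroup (v.adicCompletion ℚ))) →
        localSubgroup κ.kerSubgroup (v.adicCompletion ℚ) ≤ U → g ∈ U →
          localSubgroup (κ.layerSubgroup n) (v.adicCompletion ℚ) ≤ U)
    (A₁ : AddSubgroup (localPoints W (v.adicCompletion ℚ)))
    (hstab : ∀ (σ : absoluteGaloisGroup (v.adicCompletion ℚ)) (a : localPoints W (v.adicCompletion ℚ)),
      a ∈ A₁ → σ • a ∈ A₁)
    (hZ : ∀ a ∈ A₁, p ^ k • a = 0 → ∀ h ∈ localSubgroup (κ.layerSubgroup m₀) (v.adicCompletion ℚ), h • a = a)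
    {x y : localPoints W (v.adicCompletion ℚ)} (hx : x ∈ A₁)
    (hxi : ∀ h ∈ localSubgroup κ.kerSubgroup (v.adicCompletion ℚ), h • x = x)
    (hyi : ∀ h ∈ localSubgroup κ.kerSubgroup (v.adicCompletion ℚ), h • y = y)
    (hrel : p ^ k • x = g • y - y) :
    ∃ c : contOneCocycles (discreteTopRep (localSubgroup (κ.layerSubgroup n) (v.adicCompletion ℚ))
      (localPoints W (v.adicCompletion ℚ))),
      (∀ σ : localSubgroup (κ.layerSubgroup n) (v.adicCompletion ℚ),
        (σ : absoluteGaloisGroup (v.adicCompletion ℚ)) ∈ localSubgroup κ.kerSubgroup (v.adicCompletion ℚ) →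
          c.1 σ = 0) ∧
      c.1 ⟨g, hg⟩ = x ∧
      (∀ σ : localSubgroup (κ.layerSubgroup n) (v.adicCompletion ℚ), c.1 σ ∈ A₁) ∧
      (∀ σ : localSubgroup (κ.layerSubgroup n) (v.adicCompletion ℚ),
        p ^ k • c.1 σ = (σ : absoluteGaloisGroup (v.adicCompletion ℚ)) • y - y) := by
  -- notation (`let`, not `set`: no context rewriting)
  let K := v.adicCompletion ℚ
  let P : Type := localPoints W K
  let Hn : Subgroup (absoluteGaloisGroup K) := localSubgroup (κ.layerSubgroup n) K
  let X : TopRep ℤ Hn := discreteTopRep Hn P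
  let γ : Hn := ⟨g, hg⟩
  have hXρ : ∀ (σ : Hn) (m : P), X.ρ σ m = (σ : absoluteGaloisGroup K) • m := fun _ _ ↦ rfl
  have hXρpow : ∀ (j : ℕ) (m : P), X.ρ (γ ^ j) m = (g ^ j) • m := fun j m ↦ by
    rw [hXρ, SubgroupClass.coe_pow]
  -- `κ(res g) = p^n u`
  obtain ⟨u, hu⟩ := MultTowerSP1.exists_units_kappa_resGal_eq_of_generate hκ v hv n hg hgen
  have hgi : ∀ (R i : ℕ), g ^ i ∈ localSubgroup (κ.layerSubgroup (n + R)) K ↔ p ^ R ∣ i := fun R i ↦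
    MultTowerSP1.pow_mem_localSubgroup_layerSubgroup_iff (κ := κ) v n R hu i
  -- a common finite level `n + R₀` for `x`, `y` and the `p^k`-torsion of `A₁`
  obtain ⟨m₁, hm₁⟩ := exists_forall_mem_localSubgroup_layerSubgroup_smul_point_eq (κ := κ) v W x hxi
  obtain ⟨m₂, hm₂⟩ := exists_forall_mem_localSubgroup_layerSubgroup_smul_point_eq (κ := κ) v W y hyi
  obtain ⟨R₀, hxR₀, hyR₀, hZR₀⟩ : ∃ R₀ : ℕ, (∀ h ∈ localSubgroup (κ.layerSubgroup (n + R₀)) K, h • x = x) ∧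
      (∀ h ∈ localSubgroup (κ.layerSubgroup (n + R₀)) K, h • y = y) ∧
      (∀ a ∈ A₁, p ^ k • a = 0 → ∀ h ∈ localSubgroup (κ.layerSubgroup (n + R₀)) K, h • a = a) :=
    ⟨max (max m₁ m₂) m₀,
      fun h hh ↦ hm₁ h (MultTowerSP1.localSubgroup_layerSubgroup_antitone κ K
        (((le_max_left m₁ m₂).trans (le_max_left _ m₀)).trans (Nat.le_add_left _ n)) hh),
      fun h hh ↦ hm₂ h (MultTowerSP1.localSubgroup_layerSubgroup_antitone κ K
        (((le_max_right m₁ m₂).trans (le_max_left _ m₀)).trans (Nat.le_add_left _ n)) hh),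
      fun a ha hpa h hh ↦ hZ a ha hpa h (MultTowerSP1.localSubgroup_layerSubgroup_antitone κ K
        ((le_max_right _ m₀).trans (Nat.le_add_left _ n)) hh)⟩
  have hleR : localSubgroup (κ.layerSubgroup (n + (R₀ + k))) K ≤ localSubgroup (κ.layerSubgroup (n + R₀)) K :=
    MultTowerSP1.localSubgroup_layerSubgroup_antitone κ K (by omega)
  have hxR : ∀ h ∈ localSubgroup (κ.layerSubgroup (n + (R₀ + k))) K, h • x = x := fun h hh ↦ hxR₀ h (hleR hh)
  have hyR : ∀ h ∈ localSubgroup (κ.layerSubgroup (n + (R₀ + k))) K, h • y = y := fun h hh ↦ hyR₀ h (hleR hh)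
  -- the open normal subgroup `H = H_{n+R₀+k} ∩ H_n` of `H_n` and the cyclic quotient `H_n / H = ⟨ḡ⟩`
  have hnormal : (localSubgroup (κ.layerSubgroup (n + (R₀ + k))) K).Normal := by
    rw [localSubgroup_eq_comap]; exact Subgroup.Normal.comap inferInstance _
  let H : Subgroup Hn := (localSubgroup (κ.layerSubgroup (n + (R₀ + k))) K).subgroupOf Hn
  haveI hHnormal : H.Normal := Subgroup.normal_subgroupOf
  have hmemH : ∀ σ : Hn, σ ∈ H ↔
      (σ : absoluteGaloisGroup K) ∈ localSubgroup (κ.layerSubgroup (n + (R₀ + k))) K :=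
    fun σ ↦ Subgroup.mem_subgroupOf
  have hHopen : IsOpen (H : Set Hn) :=
    (MultTowerNS2.isOpen_localSubgroup _ (κ.isOpen_layerSubgroup (n + (R₀ + k))) K).preimage
      continuous_subtype_val
  have hgenQ : ∀ q : Hn ⧸ H, ∃ i : ℕ, q = (QuotientGroup.mk γ : Hn ⧸ H) ^ i := by
    intro q
    obtain ⟨σ, rfl⟩ := QuotientGroup.mk_surjective q
    obtain ⟨i, -, hi⟩ := exists_pow_inv_mul_mem_localSubgroup_layerSubgroup (κ := κ) v n (R₀ + k) hu σ.2
    refine ⟨i, ?_⟩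
    rw [← QuotientGroup.mk_pow, eq_comm, QuotientGroup.eq, hmemH]
    simpa only [Subgroup.coe_mul, Subgroup.coe_inv, SubgroupClass.coe_pow] using hi
  -- the order of `ḡ` is `p^(R₀+k)`
  have hord : orderOf (QuotientGroup.mk γ : Hn ⧸ H) = p ^ (R₀ + k) := by
    have key : ∀ i : ℕ, (QuotientGroup.mk γ : Hn ⧸ H) ^ i = 1 ↔ p ^ (R₀ + k) ∣ i := fun i ↦ by
      rw [← QuotientGroup.mk_pow, QuotientGroup.eq_one_iff, hmemH, SubgroupClass.coe_pow]
      exact hgi (R₀ + k) i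
    exact Nat.dvd_antisymm (orderOf_dvd_of_pow_eq_one ((key _).mpr dvd_rfl)) ((key _).mp (pow_orderOf_eq_one _))
  -- every `S_i(x)` lies in `A₁`
  have hSA : ∀ i : ℕ, geomSum (X := X) γ x i ∈ A₁ := fun i ↦ by
    induction i with
    | zero => rw [geomSum_zero]; exact A₁.zero_mem
    | succ i ih => rw [geomSum_succ, hXρpow]; exact A₁.add_mem ih (hstab _ _ hx)
  -- the norm vanishes: `S_{p^(R₀+k)}(x) = 0`
  have hN : geomSum (X := X) γ x (orderOf (QuotientGroup.mk γ : Hn ⧸ H)) = 0 := by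
    rw [hord]
    -- `p^k • S_{p^{R₀}}(x) = g^{p^{R₀}} y - y = 0`
    have hgR₀ : g ^ p ^ R₀ ∈ localSubgroup (κ.layerSubgroup (n + R₀)) K := (hgi R₀ _).mpr dvd_rfl
    have hpS : p ^ k • geomSum (X := X) γ x (p ^ R₀) = 0 := by
      rw [← geomSum_nsmul (X := X), hrel, ← hXρ γ y, geomSum_smul_sub_eq (X := X), hXρpow, hyR₀ _ hgR₀,
        sub_self]
    -- hence `S_{p^{R₀}}(x) ∈ A₁[p^k]` is fixed by `g^{p^{R₀}}`, and `S_{p^{R₀+k}}(x) = p^k • S_{p^{R₀}}(x)`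
    have hfix : X.ρ (γ ^ p ^ R₀) (geomSum (X := X) γ x (p ^ R₀)) = geomSum (X := X) γ x (p ^ R₀) := by
      rw [hXρpow]; exact hZR₀ _ (hSA _) hpS _ hgR₀
    rw [pow_add, geomSum_mul_eq_nsmul_of_apply_eq (X := X) γ x hfix (p ^ k), hpS]
  -- translates of `x` are fixed by `H_{n+R₀+k}` (normality), hence so are the sums `S_i(x)`
  have hfixS : ∀ h ∈ localSubgroup (κ.layerSubgroup (n + (R₀ + k))) K,
      ∀ i : ℕ, h • geomSum (X := X) γ x i = geomSum (X := X) γ x i := by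
    intro h hh i
    induction i with
    | zero => rw [geomSum_zero, smul_zero]
    | succ i ih =>
      rw [geomSum_succ, smul_add, ih, hXρpow]
      congr 1
      have hconj : (g ^ i)⁻¹ * h * (g ^ i) ∈ localSubgroup (κ.layerSubgroup (n + (R₀ + k))) K := by
        have := hnormal.conj_mem h hh (g ^ i)⁻¹
        rwa [inv_inv] at this
      calc h • (g ^ i) • x = (g ^ i) • (((g ^ i)⁻¹ * h * g ^ i) • x) := by
            rw [← mul_smul, ← mul_smul]; congr 1; group
        _ = (g ^ i) • x := by rw [hxR _ hconj]
  -- the cocycle `σ = g^i h ↦ S_i(x)`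
  let f : Hn → P := fun σ ↦ geomSum (X := X) γ x (idxQ H γ hgenQ (σ : Hn ⧸ H))
  have hf_cont : Continuous f := by
    haveI : DiscreteTopology (Hn ⧸ H) := QuotientGroup.discreteTopology hHopen
    have hc : Continuous (fun q : Hn ⧸ H ↦ geomSum (X := X) γ x (idxQ H γ hgenQ q)) :=
      continuous_of_discreteTopology
    exact hc.comp QuotientGroup.continuous_mk
  -- `σ = g^{idx σ} · h` with `h ∈ H_{n+R₀+k}`
  have hdec : ∀ σ : Hn, ((g ^ idxQ H γ hgenQ (σ : Hn ⧸ H))⁻¹ * (σ : absoluteGaloisGroup K)) ∈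
      localSubgroup (κ.layerSubgroup (n + (R₀ + k))) K := fun σ ↦ by
    have hh := pow_idxQ_inv_mul_mem H γ hgenQ σ
    rw [hmemH] at hh
    simpa only [Subgroup.coe_mul, Subgroup.coe_inv, SubgroupClass.coe_pow] using hh
  have hsplit : ∀ (σ : Hn) (m : P), (σ : absoluteGaloisGroup K) • m =
      (g ^ idxQ H γ hgenQ (σ : Hn ⧸ H)) • ((g ^ idxQ H γ hgenQ (σ : Hn ⧸ H))⁻¹ * (σ : absoluteGaloisGroup K)) • m :=
    fun σ m ↦ by rw [← mul_smul, mul_inv_cancel_left]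
  let c : contOneCocycles X := ⟨⟨f, hf_cont⟩, fun σ τ ↦ by
    change geomSum (X := X) γ x (idxQ H γ hgenQ ((σ * τ : Hn) : Hn ⧸ H)) =
      geomSum (X := X) γ x (idxQ H γ hgenQ (σ : Hn ⧸ H)) +
        X.ρ σ (geomSum (X := X) γ x (idxQ H γ hgenQ (τ : Hn ⧸ H)))
    rw [geomSum_eq_of_modEq (X := X) γ x hN (idxQ_mul_modEq H γ hgenQ σ τ), geomSum_add, hXρ σ, hsplit σ,
      hfixS _ (hdec σ), hXρpow]⟩
  have hc_apply : ∀ σ : Hn, c.1 σ = geomSum (X := X) γ x (idxQ H γ hgenQ (σ : Hn ⧸ H)) := fun _ ↦ rfl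
  refine ⟨c, fun σ hσ ↦ ?_, ?_, fun σ ↦ by rw [hc_apply]; exact hSA _, fun σ ↦ ?_⟩
  · -- vanishing on `H_∞ ⊆ H_{n+R₀+k}`: `idx σ ≡ 0`
    rw [hc_apply]
    have hσH : σ ∈ H := by
      rw [hmemH, mem_localSubgroup_iff]
      exact κ.kerSubgroup_le_layerSubgroup (n + (R₀ + k)) ((mem_localSubgroup_iff _ _ _).mp hσ)
    have h1 : (σ : Hn ⧸ H) = 1 := (QuotientGroup.eq_one_iff σ).mpr hσH
    have h0 : idxQ H γ hgenQ (σ : Hn ⧸ H) ≡ 0 [MOD orderOf (QuotientGroup.mk γ : Hn ⧸ H)] := by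
      rw [← pow_eq_pow_iff_modEq, pow_zero, ← idxQ_spec H γ hgenQ (σ : Hn ⧸ H), h1]
    rw [geomSum_eq_of_modEq (X := X) γ x hN h0, geomSum_zero]
  · -- `c(g) = S_1(x) = x`
    rw [hc_apply]
    have h1 : idxQ H γ hgenQ (γ : Hn ⧸ H) ≡ 1 [MOD orderOf (QuotientGroup.mk γ : Hn ⧸ H)] := by
      rw [← pow_eq_pow_iff_modEq, pow_one]
      exact (idxQ_spec H γ hgenQ (γ : Hn ⧸ H)).symm
    rw [geomSum_eq_of_modEq (X := X) γ x hN h1, geomSum_one]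
  · -- `p^k • S_i(x) = S_i(g y - y) = g^i y - y = σ y - y`
    rw [hc_apply, ← geomSum_nsmul (X := X), hrel, ← hXρ γ y, geomSum_smul_sub_eq (X := X), hXρpow,
      hsplit σ y, hyR _ (hdec σ)]

end Literature.NumberTheory.EllipticCurves.Greenberg1999.GoodOrdTower

end Part7

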